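import Literature.Analysis.FluidPDE.NSFourierMild
import Literature.Analysis.FluidPDE.NSFourierDictionary
import Literature.Analysis.FluidPDE.NSFourierPlancherel
import Mathlib.Algebra.QuadraticDiscriminant
import HarnessLib

/-!
# A priori control of Fourier-side mild solutions by an `L^∞` bound on the velocity

Second continuation-argument file on top of the Fourier-side (pseudo-measure) construction of
Leray's local regular solution (`NSFourierPicard`; the two-time mild form is in
`NSFourierMild`). For a Fourier-side mild solution `V` on `[t₀, t₁]`
(`IsFourierMild c K₀ t₀ t₁ V`) whose synthesized velocity `u(t) = 𝓕 V(t)` is bounded,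
`|u(t, x)| ≤ M` on `[t₀, t₁] × ℝ^ι`, the energy-class quantities of `u` control `V` uniformly
up to `t₁`. This file proves the first of these a priori bounds, the **enstrophy bound**: with
the Fourier-side enstrophy `E(V(t)) = ∫ ‖ξ‖² ‖V(t, ξ)‖² dξ` (`= (4π²)⁻¹ ‖∇u(t)‖²_{L²}` by
Plancherel),

* `IsFourierMild.enst_le`: for `s ≤ t` in `[t₀, t₁]`,
  `E(V(t)) ≤ 2 E(V(s)) + (C_ι M)² (t - s) c⁻¹ · sup_{[s,t]} E(V)`;
* `IsFourierMild.enst_le_four_mul`: hence `E(V) ≤ 4 E(V(s))` on every window `[s, s + h]`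
  with `(C_ι M)² h ≤ c/2`, and `IsFourierMild.enst_le_pow`: `E(V(t)) ≤ 4ⁿ E(V(t₀))` on
  `[t₀, t₀ + n h]`.

This is the Fourier-side form of the enstrophy inequality under an `L^∞` bound,
`d/dt ‖∇u‖² ≤ -ν‖Δu‖² + ν⁻¹ M² ‖∇u‖²` (Lemarié-Rieusset 2016, Thm. 11.2 with `(p, q) = (2, ∞)`;
Leray 1934, §20, (3.5)–(3.9): a regular solution bounded by `M` is controlled on time
intervals of length `∼ ν M⁻²`), obtained here without time derivatives from the two-time
Duhamel formula: the Duhamel term `D = ∫ₛᵗ e^{-c‖ξ‖²(t-r)} N(V(r), V(r)) dr` obeys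
`‖ξ‖² ‖D(ξ)‖² ≤ (2c)⁻¹ ∫ₛᵗ ‖N(V(r), V(r))(ξ)‖² dr` (Cauchy–Schwarz in time and
`2c‖ξ‖² ∫ₛᵗ e^{-2c‖ξ‖²(t-r)} dr ≤ 1`), Tonelli exchanges `ξ` and `r`, and the `L²_ξ`-norm of
the nonlinearity is bounded through Plancherel by the physical product estimate
`‖u ∂u‖_{L²} ≤ M ‖∂u‖_{L²}`: `‖N(V, V)‖_{L²_ξ} ≤ C_ι M ‖ ‖ξ‖ V ‖_{L²_ξ}`
(`eLpNorm_nonlin_le`; the frequency Leibniz rule `ξᵢ (f ⋆ g) = (ηᵢ f) ⋆ g + f ⋆ (ηᵢ g)` and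
`‖f ⋆ g‖_{L²} = ‖𝓕f · 𝓕g‖_{L²} ≤ ‖𝓕g‖_∞ ‖f‖_{L²}`).

## Mathlib search

`MeasureTheory.convolution_mul_swap` (commutativity of `⋆[mul]`), `discrim_le_zero` (for the
Cauchy–Schwarz inequality of interval integrals), `intervalIntegral.integral_eq_sub_of_hasDerivAt`,
`MeasureTheory.lintegral_lintegral_swap`, `MeasureTheory.ofReal_integral_eq_lintegral_ofReal`,
`eLpNorm_le_mul_eLpNorm_of_ae_le_mul`, `eLpNorm_sum_le`, `eLpNorm_nnreal_pow_eq_lintegral`.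
No Mathlib statement of Young/Cauchy–Schwarz for `intervalIntegral` in squared form was found
(searched `sq_integral`, `integral_mul_le`); `integral_mul_le_Lp_mul_Lq_of_nonneg` is the
`rpow` form.

## References

* J. Leray, Acta Math. 63 (1934), §20, (3.5)–(3.9); §21. [Leray1934]
* P. G. Lemarié-Rieusset, *The Navier–Stokes problem in the 21st century*, CRC 2016, Thm. 7.2,
  Thm. 11.2, §8.5.
* W. S. Ożański, B. C. Pooley, LMS LN 452, CUP 2018, Lemma 6.19, Cor. 6.25. [OzanskiPooley2018]
-/

noncomputable section

open MeasureTheory Real Set Filter Topology Function intervalIntegral Complex FourierTransform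
open scoped ComplexConjugate FourierTransform RealInnerProductSpace ENNReal

namespace Literature.Analysis.FluidPDE.FourierNS

variable {ι : Type*} [Fintype ι]

/-! ### Two elementary inequalities -/

omit [Fintype ι] in
/-- **Cauchy–Schwarz for interval integrals of continuous functions**, squared form:
`(∫ₐᵇ f g)² ≤ (∫ₐᵇ f²)(∫ₐᵇ g²)` for `a ≤ b` (discriminant of `λ ↦ ∫ (λ f - g)² ≥ 0`). [folklore] -/
theorem sq_integral_mul_le {f g : ℝ → ℝ} (hf : Continuous f) (hg : Continuous g) {a b : ℝ}
    (hab : a ≤ b) :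
    (∫ x in a..b, f x * g x) ^ 2 ≤ (∫ x in a..b, f x ^ 2) * ∫ x in a..b, g x ^ 2 := by
  have hi : ∀ {φ : ℝ → ℝ}, Continuous φ → IntervalIntegrable φ volume a b := fun hφ =>
    hφ.intervalIntegrable _ _
  -- `0 ≤ ∫ (x f - g)² = (∫ f²) x² - 2 (∫ f g) x + ∫ g²`
  have hq : ∀ x : ℝ, 0 ≤ (∫ t in a..b, f t ^ 2) * (x * x) + (-2 * ∫ t in a..b, f t * g t) * x +
      ∫ t in a..b, g t ^ 2 := by
    intro x
    have h0 : 0 ≤ ∫ t in a..b, (x * f t - g t) ^ 2 :=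
      intervalIntegral.integral_nonneg hab fun t _ => sq_nonneg _
    have hexp : ∫ t in a..b, (x * f t - g t) ^ 2 =
        (∫ t in a..b, f t ^ 2) * (x * x) + (-2 * ∫ t in a..b, f t * g t) * x +
          ∫ t in a..b, g t ^ 2 := by
      have e1 : (fun t => (x * f t - g t) ^ 2) =
          fun t => (x * x) * f t ^ 2 + (-2 * x) * (f t * g t) + g t ^ 2 := by
        funext t; ring
      rw [e1, intervalIntegral.integral_add ((hi (by fun_prop)).add (hi (by fun_prop)))
        (hi (by fun_prop)), intervalIntegral.integral_add (hi (by fun_prop)) (hi (by fun_prop)),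
        intervalIntegral.integral_const_mul, intervalIntegral.integral_const_mul]
      ring
    rw [← hexp]; exact h0
  have hd := discrim_le_zero hq
  rw [discrim] at hd
  nlinarith [hd]

omit [Fintype ι] in
/-- The heat gain of one derivative in `L²_t`: `2c‖ξ‖² ∫ₛᵗ e^{-2c‖ξ‖²(t-r)} dr ≤ 1`
(`= 1 - e^{-2c‖ξ‖²(t-s)} ≤ 1`, for all real `c`, `s`, `t`). [folklore] -/
theorem two_mul_norm_sq_mul_integral_heat_sq_le {E : Type*} [NormedAddCommGroup E] (c : ℝ)
    (ξ : E) (s t : ℝ) :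
    2 * c * ‖ξ‖ ^ 2 * ∫ r in s..t, heat c ξ (t - r) ^ 2 ≤ 1 := by
  -- `d/dr e^{-2c‖ξ‖²(t-r)} = 2c‖ξ‖² e^{-2c‖ξ‖²(t-r)}`
  set α : ℝ := 2 * c * ‖ξ‖ ^ 2 with hα
  have hsq : ∀ r, heat c ξ (t - r) ^ 2 = Real.exp (α * r - α * t) := fun r => by
    rw [heat, ← Real.exp_nat_mul]; congr 1; push_cast; rw [hα]; ring
  have hderiv : ∀ r, HasDerivAt (fun r => Real.exp (α * r - α * t))
      (α * Real.exp (α * r - α * t)) r := by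
    intro r
    have h1 : HasDerivAt (fun r => α * r - α * t) (α * 1) r :=
      ((hasDerivAt_id r).const_mul α).sub_const (α * t)
    have h2 := h1.exp
    rw [mul_one] at h2
    simpa [mul_comm] using h2
  have hFTC : ∫ r in s..t, α * Real.exp (α * r - α * t) =
      Real.exp (α * t - α * t) - Real.exp (α * s - α * t) :=
    intervalIntegral.integral_eq_sub_of_hasDerivAt (fun r _ => hderiv r)
      ((Continuous.intervalIntegrable (by fun_prop)) _ _)
  calc α * ∫ r in s..t, heat c ξ (t - r) ^ 2
      = ∫ r in s..t, α * Real.exp (α * r - α * t) := by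
        rw [← intervalIntegral.integral_const_mul]
        exact intervalIntegral.integral_congr fun r _ => by rw [hsq]
    _ = 1 - Real.exp (α * s - α * t) := by rw [hFTC]; simp
    _ ≤ 1 := by linarith [Real.exp_pos (α * s - α * t)]

/-! ### `L²` bookkeeping -/

omit [Fintype ι] in
/-- `‖f‖²_{L²} = ∫⁻ ‖f‖ₑ²` (Mathlib `eLpNorm_nnreal_pow_eq_lintegral` at `p = 2`). [folklore] -/
theorem eLpNorm_two_sq {X : Type*} [MeasurableSpace X] {μ : Measure X} {F : Type*}
    [NormedAddCommGroup F] (f : X → F) : eLpNorm f 2 μ ^ 2 = ∫⁻ x, ‖f x‖ₑ ^ 2 ∂μ := by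
  have h := eLpNorm_nnreal_pow_eq_lintegral (f := f) (μ := μ) (p := (2 : NNReal)) two_ne_zero
  simpa only [ENNReal.coe_ofNat, NNReal.coe_ofNat, ENNReal.rpow_two] using h

omit [Fintype ι] in
/-- `‖a‖ₑ² = ofReal (a²)` for a real number. [folklore] -/
theorem enorm_sq_eq_ofReal_sq (a : ℝ) : ‖a‖ₑ ^ 2 = ENNReal.ofReal (a ^ 2) := by
  rw [Real.enorm_eq_ofReal_abs, ← ENNReal.ofReal_pow (abs_nonneg a), sq_abs]

omit [Fintype ι] in
/-- For `x : ι → ℂ`, `‖x‖ ≤ ∑ l, ‖x l‖`. [folklore] -/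
theorem pi_norm_le_sum_norm {κ : Type*} [Fintype κ] (x : κ → ℂ) : ‖x‖ ≤ ∑ l, ‖x l‖ :=
  (pi_norm_le_iff_of_nonneg (Finset.sum_nonneg fun l' _ => norm_nonneg (x l'))).2 fun l =>
    Finset.single_le_sum (fun l' _ => norm_nonneg (x l')) (Finset.mem_univ l)

/-! ### The Fourier-side enstrophy -/

/-- The Fourier-side enstrophy `E(f) = ∫ ‖ξ‖² ‖f(ξ)‖² dξ` of a coefficient field
(`= (4π²)⁻¹ ‖∇ 𝓕f‖²_{L²}` by Plancherel and `∂ₕ 𝓕 f = 𝓕(-2πi⟪ξ,h⟫ f)`). [folklore] -/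
def enst (f : EuclideanSpace ℝ ι → ι → ℂ) : ℝ≥0∞ :=
  ∫⁻ ξ, ENNReal.ofReal (‖ξ‖ ^ 2 * ‖f ξ‖ ^ 2)

/-- `E(f) = ‖ ‖ξ‖ ‖f(ξ)‖ ‖²_{L²}`. [folklore] -/
theorem enst_eq_eLpNorm_sq (f : EuclideanSpace ℝ ι → ι → ℂ) :
    enst f = eLpNorm (fun ξ => ‖ξ‖ * ‖f ξ‖) 2 volume ^ 2 := by
  rw [eLpNorm_two_sq, enst]
  refine lintegral_congr fun ξ => ?_
  rw [enorm_sq_eq_ofReal_sq, mul_pow]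

/-- A decay bound of order `K₀ + 1`, `K₀ > card ι`, makes the enstrophy finite:
`E(f) ≤ A² I_{2K₀}`-type bound. [folklore] -/
theorem enst_lt_top_of_hasDecay {K₀ : ℕ} (hK₀ : Fintype.card ι < K₀) {A : ℝ}
    {f : EuclideanSpace ℝ ι → ι → ℂ} (hf : HasDecay (K₀ + 1) A f) : enst f < ⊤ := by
  have hA := hf.nonneg
  have hint := (integrable_inv_one_add_norm_pow (E := EuclideanSpace ℝ ι)
    (finrank_lt_of_card_lt hK₀)).const_mul (A ^ 2)
  refine lt_of_le_of_lt (lintegral_mono fun ξ => ?_)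
    ((hasFiniteIntegral_iff_ofReal (Eventually.of_forall fun ξ => by positivity)).1 hint.2)
  refine ENNReal.ofReal_le_ofReal ?_
  have hw : 0 < 1 + ‖ξ‖ := by positivity
  have h1 : ‖ξ‖ * ‖f ξ‖ ≤ A * ((1 + ‖ξ‖) ^ K₀)⁻¹ := by
    calc ‖ξ‖ * ‖f ξ‖ ≤ (1 + ‖ξ‖) * (A * ((1 + ‖ξ‖) ^ (K₀ + 1))⁻¹) :=
          mul_le_mul (by linarith [norm_nonneg ξ]) (hf ξ) (norm_nonneg _) hw.le
      _ = A * ((1 + ‖ξ‖) ^ K₀)⁻¹ := by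
          rw [pow_succ]; field_simp
  have h0 : 0 ≤ ‖ξ‖ * ‖f ξ‖ := by positivity
  calc ‖ξ‖ ^ 2 * ‖f ξ‖ ^ 2 = (‖ξ‖ * ‖f ξ‖) ^ 2 := by ring
    _ ≤ (A * ((1 + ‖ξ‖) ^ K₀)⁻¹) ^ 2 := pow_le_pow_left₀ h0 h1 2
    _ = A ^ 2 * ((1 + ‖ξ‖) ^ K₀)⁻¹ * ((1 + ‖ξ‖) ^ K₀)⁻¹ := by ring
    _ ≤ A ^ 2 * ((1 + ‖ξ‖) ^ K₀)⁻¹ * 1 := by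
        gcongr
        exact inv_one_add_norm_pow_le_one ξ K₀
    _ = A ^ 2 * ((1 + ‖ξ‖) ^ K₀)⁻¹ := mul_one _

/-! ### Convolution: commutativity and the frequency Leibniz rule -/

/-- Commutativity of the frequency convolution (Mathlib `convolution_mul_swap`). [folklore] -/
theorem fconv_comm (f g : EuclideanSpace ℝ ι → ℂ) (ξ : EuclideanSpace ℝ ι) :
    fconv f g ξ = fconv g f ξ := by
  rw [fconv_eq, convolution_mul_swap, fconv_apply]
  exact integral_congr_ae (Eventually.of_forall fun η => mul_comm _ _)

/-- **Frequency Leibniz rule**: `ξᵢ (f ⋆ g)(ξ) = ((ηᵢ f) ⋆ g)(ξ) + (f ⋆ (ηᵢ g))(ξ)`, the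
Fourier-side form of `∂ᵢ(φψ) = (∂ᵢφ)ψ + φ ∂ᵢψ` (`ξᵢ = ηᵢ + (ξ - η)ᵢ` under the integral). [folklore] -/
theorem coord_mul_fconv {f g : EuclideanSpace ℝ ι → ℂ} {ξ : EuclideanSpace ℝ ι} (i : ι)
    (h₁ : Integrable fun η => (((η i : ℝ) : ℂ) * f η) * g (ξ - η))
    (h₂ : Integrable fun η => f η * ((((ξ - η) i : ℝ) : ℂ) * g (ξ - η))) :
    ((ξ i : ℝ) : ℂ) * fconv f g ξ =
      fconv (fun η => ((η i : ℝ) : ℂ) * f η) g ξ + fconv f (fun η => ((η i : ℝ) : ℂ) * g η) ξ := by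
  simp only [fconv_apply]
  rw [← integral_add h₁ h₂, ← MeasureTheory.integral_const_mul]
  refine integral_congr_ae (Eventually.of_forall fun η => ?_)
  have : ((ξ i : ℝ) : ℂ) = ((η i : ℝ) : ℂ) + (((ξ - η) i : ℝ) : ℂ) := by
    rw [← Complex.ofReal_add, PiLp.sub_apply]; congr 1; ring
  rw [this]; ring

/-! ### Plancherel bound for a convolution with a factor of bounded synthesis -/

variable {K₀ : ℕ}

/-- A convolution with an integrable factor and a bounded factor is bounded:
`‖(f ⋆ g)(ξ)‖ ≤ B ‖f‖_{L¹}` when `‖g‖ ≤ B`. [folklore] -/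
theorem norm_fconv_le_mul_integral_norm {f g : EuclideanSpace ℝ ι → ℂ} (hf : Integrable f)
    {B : ℝ} (hgB : ∀ η, ‖g η‖ ≤ B) (ξ : EuclideanSpace ℝ ι) :
    ‖fconv f g ξ‖ ≤ B * ∫ η, ‖f η‖ := by
  have hB : 0 ≤ B := (norm_nonneg _).trans (hgB 0)
  rw [fconv_apply]
  calc ‖∫ η, f η * g (ξ - η)‖ ≤ ∫ η, ‖f η * g (ξ - η)‖ := norm_integral_le_integral_norm _
    _ ≤ ∫ η, B * ‖f η‖ := by
        refine integral_mono_of_nonneg (Eventually.of_forall fun η => norm_nonneg _)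
          (hf.norm.const_mul B) (Eventually.of_forall fun η => ?_)
        show ‖f η * g (ξ - η)‖ ≤ B * ‖f η‖
        rw [norm_mul, mul_comm]
        exact mul_le_mul_of_nonneg_right (hgB _) (norm_nonneg _)
    _ = B * ∫ η, ‖f η‖ := MeasureTheory.integral_const_mul _ _

/-- **`‖f ⋆ g‖_{L²} ≤ ‖𝓕 g‖_∞ ‖f‖_{L²}`** for `f ∈ L¹ ∩ L²` and `g` integrable and bounded with
bounded synthesis `|𝓕 g| ≤ M`: Plancherel (`‖f ⋆ g‖_{L²} = ‖𝓕(f ⋆ g)‖_{L²}`,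
`‖f‖_{L²} = ‖𝓕 f‖_{L²}`) and `𝓕(f ⋆ g) = 𝓕f · 𝓕g` — the physical product estimate
`‖φ ψ‖_{L²} ≤ ‖ψ‖_∞ ‖φ‖_{L²}` read on the Fourier side. [folklore] -/
theorem eLpNorm_fconv_le_left {f g : EuclideanSpace ℝ ι → ℂ} (hf : Integrable f)
    (hf2 : MemLp f 2 volume) (hg : Integrable g) {B : ℝ} (hgB : ∀ η, ‖g η‖ ≤ B) {M : ℝ}
    (hM : ∀ x, ‖𝓕 g x‖ ≤ M) :
    eLpNorm (fconv f g) 2 volume ≤ ENNReal.ofReal M * eLpNorm f 2 volume := by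
  have hi : Integrable (fconv f g) := integrable_fconv hf hg
  have hb : ∀ ξ, ‖fconv f g ξ‖ ≤ B * ∫ η, ‖f η‖ := fun ξ =>
    norm_fconv_le_mul_integral_norm hf hgB ξ
  have h2 : MemLp (fconv f g) 2 volume := memLp_two_of_bound hi hb
  calc eLpNorm (fconv f g) 2 volume = eLpNorm (𝓕 (fconv f g)) 2 volume :=
        (eLpNorm_fourierIntegral_eq hi h2).symm
    _ ≤ ENNReal.ofReal M * eLpNorm (𝓕 f) 2 volume := by
        refine eLpNorm_le_mul_eLpNorm_of_ae_le_mul (Eventually.of_forall fun x => ?_) 2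
        rw [← fourier_mul_fourier' hf hg x, norm_mul, mul_comm]
        exact mul_le_mul_of_nonneg_right (hM x) (norm_nonneg _)
    _ = ENNReal.ofReal M * eLpNorm f 2 volume := by rw [eLpNorm_fourierIntegral_eq hf hf2]

/-- The same with the bounded-synthesis factor on the left: `‖g ⋆ f‖_{L²} ≤ ‖𝓕 g‖_∞ ‖f‖_{L²}`. [folklore] -/
theorem eLpNorm_fconv_le_right {f g : EuclideanSpace ℝ ι → ℂ} (hf : Integrable f)
    (hf2 : MemLp f 2 volume) (hg : Integrable g) {B : ℝ} (hgB : ∀ η, ‖g η‖ ≤ B) {M : ℝ}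
    (hM : ∀ x, ‖𝓕 g x‖ ≤ M) :
    eLpNorm (fconv g f) 2 volume ≤ ENNReal.ofReal M * eLpNorm f 2 volume := by
  have : fconv g f = fconv f g := funext fun ξ => fconv_comm g f ξ
  rw [this]; exact eLpNorm_fconv_le_left hf hf2 hg hgB hM

/-! ### The `L²` bound of the nonlinearity under an `L^∞` bound on the velocity -/

/-- `‖ξ‖ ≤ ∑ᵢ |ξᵢ|` on `EuclideanSpace ℝ ι`. [folklore] -/
theorem norm_le_sum_abs_apply (ξ : EuclideanSpace ℝ ι) : ‖ξ‖ ≤ ∑ i, |ξ i| := by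
  have hs : 0 ≤ ∑ i, |ξ i| := Finset.sum_nonneg fun i _ => abs_nonneg _
  have hsq : ‖ξ‖ ^ 2 ≤ (∑ i, |ξ i|) ^ 2 := by
    rw [EuclideanSpace.real_norm_sq_eq, sq, Finset.sum_mul]
    refine Finset.sum_le_sum fun i _ => ?_
    rw [← sq_abs, sq]
    exact mul_le_mul_of_nonneg_left
      (Finset.single_le_sum (fun j _ => abs_nonneg (ξ j)) (Finset.mem_univ i)) (abs_nonneg _)
  exact (pow_le_pow_iff_left₀ (norm_nonneg _) hs two_ne_zero).1 hsq

omit [Fintype ι] in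
/-- The coordinate multiplier `η ↦ (ηᵢ : ℂ)` is continuous. [folklore] -/
theorem continuous_coord_ofReal (i : ι) :
    Continuous fun η : EuclideanSpace ℝ ι => ((η i : ℝ) : ℂ) :=
  Complex.continuous_ofReal.comp (EuclideanSpace.proj i).continuous

section Nonlin

variable [DecidableEq ι]

omit [DecidableEq ι] in
/-- `|ηᵢ| ‖v(η)ⱼ‖ ≤ A (1+‖η‖)^{-K₀}` for `v` with decay of order `1 + K₀`. [folklore] -/
theorem abs_coord_mul_norm_le {A : ℝ} {v : EuclideanSpace ℝ ι → ι → ℂ}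
    (hv : HasDecay (1 + K₀) A v) (η : EuclideanSpace ℝ ι) (i j : ι) :
    |η i| * ‖v η j‖ ≤ A * ((1 + ‖η‖) ^ K₀)⁻¹ := by
  have hw : 0 < 1 + ‖η‖ := by positivity
  calc |η i| * ‖v η j‖ ≤ (1 + ‖η‖) * (A * ((1 + ‖η‖) ^ (1 + K₀))⁻¹) :=
        mul_le_mul ((abs_apply_le_norm η i).trans (by linarith [norm_nonneg η]))
          ((hv.apply j) η) (norm_nonneg _) hw.le
    _ = A * ((1 + ‖η‖) ^ K₀)⁻¹ := by
        rw [show 1 + K₀ = K₀ + 1 from add_comm _ _, pow_succ']; field_simp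

omit [DecidableEq ι] in
/-- Integrability of `ηᵢ v(η)ⱼ` for `v` with decay of order `1 + K₀`. [folklore] -/
theorem integrable_coord_mul (hK₀ : Fintype.card ι < K₀) {A : ℝ}
    {v : EuclideanSpace ℝ ι → ι → ℂ} (hv : HasDecay (1 + K₀) A v)
    (hvm : AEStronglyMeasurable v volume) (i j : ι) :
    Integrable fun η : EuclideanSpace ℝ ι => ((η i : ℝ) : ℂ) * v η j := by
  have hA := hv.nonneg
  have hint := (integrable_inv_one_add_norm_pow (E := EuclideanSpace ℝ ι)
    (finrank_lt_of_card_lt hK₀)).const_mul A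
  refine hint.mono' ((continuous_coord_ofReal i).aestronglyMeasurable.mul (aesm_apply hvm j))
    (Eventually.of_forall fun η => ?_)
  rw [norm_mul, Complex.norm_real, Real.norm_eq_abs]
  exact abs_coord_mul_norm_le hv η i j

omit [DecidableEq ι] in
/-- The constant `C_ι = 8π (card ι)⁴` of the `L²` bound of the nonlinearity. [folklore] -/
def nonlinL2Const (ι : Type*) [Fintype ι] : ℝ := 8 * π * (Fintype.card ι : ℝ) ^ 4

omit [DecidableEq ι] in
/-- `0 ≤ C_ι`. [folklore] -/
theorem nonlinL2Const_nonneg : 0 ≤ nonlinL2Const ι := by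
  unfold nonlinL2Const; positivity

/-- **`L²` bound of the nonlinearity under an `L^∞` bound on the synthesis.** If `v` is
continuous with decay of order `1 + K₀` (`K₀ > card ι`) and its synthesis is bounded,
`|𝓕 vₗ(x)| ≤ M` for all `x, l`, then `‖N(v, v)‖_{L²_ξ} ≤ C_ι M ‖ ‖ξ‖ v ‖_{L²_ξ}`. On the
physical side this is `‖ℙ ∇·(u ⊗ u)‖_{L²} ≤ C ‖u‖_∞ ‖∇u‖_{L²}`; here: symbol bound
`|m_{jkl}(ξ)| ≤ 2‖ξ‖ ≤ 2∑ᵢ|ξᵢ|`, the frequency Leibniz rule and the Plancherel bound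
`eLpNorm_fconv_le_left/right`. [folklore] -/
theorem eLpNorm_nonlin_le (hK₀ : Fintype.card ι < K₀) {A : ℝ}
    {v : EuclideanSpace ℝ ι → ι → ℂ} (hvc : Continuous v) (hv : HasDecay (1 + K₀) A v) {M : ℝ}
    (hM : ∀ x l, ‖𝓕 (fun ξ => v ξ l) x‖ ≤ M) :
    eLpNorm (nonlin v v) 2 volume ≤
      ENNReal.ofReal (nonlinL2Const ι * M) * eLpNorm (fun ξ => ‖ξ‖ * ‖v ξ‖) 2 volume := by
  rcases isEmpty_or_nonempty ι with hι | hι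
  · -- no components: the nonlinearity vanishes
    have : nonlin v v = 0 := funext fun ξ => funext fun l => (IsEmpty.false l).elim
    rw [this, eLpNorm_zero]; exact zero_le
  have hM0 : 0 ≤ M := (norm_nonneg _).trans (hM 0 (Classical.arbitrary ι))
  have hA := hv.nonneg
  have hvm : AEStronglyMeasurable v volume := hvc.aestronglyMeasurable
  have hv₀ : HasDecay K₀ A v := hv.of_le (by omega)
  set W : ℝ≥0∞ := eLpNorm (fun ξ : EuclideanSpace ℝ ι => ‖ξ‖ * ‖v ξ‖) 2 volume with hW
  -- the factors `vⱼ` and `ηᵢ vⱼ`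
  set vj : ι → EuclideanSpace ℝ ι → ℂ := fun j η => v η j with hvj
  set wj : ι → ι → EuclideanSpace ℝ ι → ℂ := fun i j η => ((η i : ℝ) : ℂ) * v η j with hwj
  have hvj_c : ∀ j, Continuous (vj j) := fun j => (continuous_apply j).comp hvc
  have hwj_c : ∀ i j, Continuous (wj i j) := fun i j => (continuous_coord_ofReal i).mul (hvj_c j)
  have hvj_int : ∀ j, Integrable (vj j) := fun j =>
    (hv₀.apply j).integrable (finrank_lt_of_card_lt hK₀) (aesm_apply hvm j)
  have hvj_bd : ∀ j η, ‖vj j η‖ ≤ A := fun j η => (hv₀.apply j).norm_le η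
  have hwj_int : ∀ i j, Integrable (wj i j) := fun i j => integrable_coord_mul hK₀ hv hvm i j
  have hwj_bd : ∀ i j η, ‖wj i j η‖ ≤ A := fun i j η => by
    simp only [hwj]
    rw [norm_mul, Complex.norm_real, Real.norm_eq_abs]
    exact (abs_coord_mul_norm_le hv η i j).trans
      (mul_le_of_le_one_right hA (inv_one_add_norm_pow_le_one η K₀))
  have hwj_2 : ∀ i j, MemLp (wj i j) 2 volume := fun i j =>
    memLp_two_of_bound (hwj_int i j) (hwj_bd i j)
  have hM' : ∀ j x, ‖𝓕 (vj j) x‖ ≤ M := fun j x => hM x j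
  -- the weighted `L²` norm dominates each `ηᵢ vⱼ`
  have hw_le : ∀ i j, eLpNorm (wj i j) 2 volume ≤ W := by
    intro i j
    refine eLpNorm_mono_real (fun η => ?_)
    simp only [hwj]
    rw [norm_mul, Complex.norm_real, Real.norm_eq_abs]
    exact mul_le_mul (abs_apply_le_norm η i) (norm_le_pi_norm (v η) j) (norm_nonneg _)
      (norm_nonneg _)
  -- the two families of convolutions and their `L²` bounds
  set F₁ : ι × ι × ι → EuclideanSpace ℝ ι → ℂ := fun σ => fconv (wj σ.2.2 σ.1) (vj σ.2.1) with hF₁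
  set F₂ : ι × ι × ι → EuclideanSpace ℝ ι → ℂ := fun σ => fconv (vj σ.1) (wj σ.2.2 σ.2.1) with hF₂
  have hF₁_le : ∀ σ, eLpNorm (F₁ σ) 2 volume ≤ ENNReal.ofReal M * W := fun σ =>
    (eLpNorm_fconv_le_left (hwj_int _ _) (hwj_2 _ _) (hvj_int _) (hvj_bd _) (hM' _)).trans
      (by gcongr; exact hw_le _ _)
  have hF₂_le : ∀ σ, eLpNorm (F₂ σ) 2 volume ≤ ENNReal.ofReal M * W := fun σ =>
    (eLpNorm_fconv_le_right (hwj_int _ _) (hwj_2 _ _) (hvj_int _) (hvj_bd _) (hM' _)).trans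
      (by gcongr; exact hw_le _ _)
  have hF₁_m : ∀ σ, AEStronglyMeasurable (F₁ σ) volume := fun σ =>
    (integrable_fconv (hwj_int _ _) (hvj_int _)).aestronglyMeasurable
  have hF₂_m : ∀ σ, AEStronglyMeasurable (F₂ σ) volume := fun σ =>
    (integrable_fconv (hvj_int _) (hwj_int _ _)).aestronglyMeasurable
  -- the frequency Leibniz rule for `vⱼ ⋆ vₖ`
  have hLeib : ∀ (i j k : ι) (ξ : EuclideanSpace ℝ ι),
      ((ξ i : ℝ) : ℂ) * fconv (vj j) (vj k) ξ = F₁ (j, k, i) ξ + F₂ (j, k, i) ξ := by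
    intro i j k ξ
    refine coord_mul_fconv i ?_ ?_
    · exact (hwj_int i j).mul_bdd ((hvj_c k).comp (continuous_const.sub continuous_id)
        |>.aestronglyMeasurable) (Eventually.of_forall fun η => hvj_bd k _)
    · exact (hvj_int j).mul_bdd ((hwj_c i k).comp (continuous_const.sub continuous_id)
        |>.aestronglyMeasurable) (Eventually.of_forall fun η => hwj_bd i k _)
  -- pointwise bound of the nonlinearity
  set G : ι × ι × ι → EuclideanSpace ℝ ι → ℝ := fun σ ξ => ‖F₁ σ ξ‖ + ‖F₂ σ ξ‖ with hG
  set c₀ : ℝ := (Fintype.card ι : ℝ) * (4 * π) with hc₀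
  have hc₀0 : 0 ≤ c₀ := by positivity
  have hpt : ∀ ξ, ‖nonlin v v ξ‖ ≤ c₀ * ∑ σ, G σ ξ := by
    intro ξ
    -- each component
    have hcomp : ∀ l, ‖nonlin v v ξ l‖ ≤ 4 * π * ∑ σ, G σ ξ := by
      intro l
      rw [nonlin_apply, norm_mul]
      have h2π : ‖-(2 * (π : ℂ) * Complex.I)‖ = 2 * π := by
        simp [Complex.norm_real, Real.norm_eq_abs, abs_of_pos Real.pi_pos]
      rw [h2π]
      have hterm : ∀ j k, ‖(lerayDerivSymbol j k l ξ : ℂ) * fconv (v · j) (v · k) ξ‖ ≤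
          2 * ∑ i, G (j, k, i) ξ := by
        intro j k
        rw [norm_mul]
        calc ‖(lerayDerivSymbol j k l ξ : ℂ)‖ * ‖fconv (v · j) (v · k) ξ‖
            ≤ 2 * ‖ξ‖ * ‖fconv (vj j) (vj k) ξ‖ :=
              mul_le_mul_of_nonneg_right (norm_ofReal_lerayDerivSymbol_le j k l ξ) (norm_nonneg _)
          _ ≤ 2 * (∑ i, |ξ i|) * ‖fconv (vj j) (vj k) ξ‖ := by
              gcongr; exact norm_le_sum_abs_apply ξ
          _ = 2 * ∑ i, ‖((ξ i : ℝ) : ℂ) * fconv (vj j) (vj k) ξ‖ := by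
              rw [mul_assoc, Finset.sum_mul]
              congr 1
              refine Finset.sum_congr rfl fun i _ => ?_
              rw [norm_mul, Complex.norm_real, Real.norm_eq_abs]
          _ ≤ 2 * ∑ i, G (j, k, i) ξ := by
              gcongr with i
              rw [hLeib]
              exact norm_add_le _ _
      calc 2 * π * ‖∑ j, ∑ k, (lerayDerivSymbol j k l ξ : ℂ) * fconv (v · j) (v · k) ξ‖
          ≤ 2 * π * ∑ j, ∑ k, ‖(lerayDerivSymbol j k l ξ : ℂ) * fconv (v · j) (v · k) ξ‖ := by
            gcongr
            exact (norm_sum_le _ _).trans (Finset.sum_le_sum fun j _ => norm_sum_le _ _)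
        _ ≤ 2 * π * ∑ j, ∑ k, 2 * ∑ i, G (j, k, i) ξ := by
            gcongr with j _ k _
            exact hterm j k
        _ = 4 * π * ∑ σ, G σ ξ := by
            simp_rw [Fintype.sum_prod_type, ← Finset.mul_sum]
            ring
    calc ‖nonlin v v ξ‖ ≤ ∑ l, ‖nonlin v v ξ l‖ := pi_norm_le_sum_norm _
      _ ≤ ∑ _l : ι, 4 * π * ∑ σ, G σ ξ := Finset.sum_le_sum fun l _ => hcomp l
      _ = c₀ * ∑ σ, G σ ξ := by
          rw [Finset.sum_const, Finset.card_univ, nsmul_eq_mul, hc₀]; ring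
  -- `L²` norms
  have hG_m : ∀ σ, AEStronglyMeasurable (G σ) volume := fun σ =>
    (hF₁_m σ).norm.add (hF₂_m σ).norm
  have hG_le : ∀ σ, eLpNorm (G σ) 2 volume ≤ 2 * (ENNReal.ofReal M * W) := by
    intro σ
    calc eLpNorm (G σ) 2 volume
        ≤ eLpNorm (fun ξ => ‖F₁ σ ξ‖) 2 volume + eLpNorm (fun ξ => ‖F₂ σ ξ‖) 2 volume :=
          eLpNorm_add_le (hF₁_m σ).norm (hF₂_m σ).norm (by norm_num)
      _ ≤ ENNReal.ofReal M * W + ENNReal.ofReal M * W := by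
          rw [eLpNorm_norm, eLpNorm_norm]; exact add_le_add (hF₁_le σ) (hF₂_le σ)
      _ = 2 * (ENNReal.ofReal M * W) := by ring
  have hsum : eLpNorm (fun ξ => ∑ σ, G σ ξ) 2 volume ≤
      (Fintype.card (ι × ι × ι) : ℝ≥0∞) * (2 * (ENNReal.ofReal M * W)) := by
    have hfun : (fun ξ => ∑ σ, G σ ξ) = ∑ σ, G σ := by
      funext ξ; simp only [Finset.sum_apply]
    rw [hfun]
    calc eLpNorm (∑ σ, G σ) 2 volume ≤ ∑ σ, eLpNorm (G σ) 2 volume :=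
          eLpNorm_sum_le (fun σ _ => hG_m σ) (by norm_num)
      _ ≤ ∑ _σ : ι × ι × ι, 2 * (ENNReal.ofReal M * W) := Finset.sum_le_sum fun σ _ => hG_le σ
      _ = (Fintype.card (ι × ι × ι) : ℝ≥0∞) * (2 * (ENNReal.ofReal M * W)) := by
          rw [Finset.sum_const, Finset.card_univ, nsmul_eq_mul]
  -- assemble
  have hconst : ENNReal.ofReal c₀ * ((Fintype.card (ι × ι × ι) : ℝ≥0∞) * (2 * ENNReal.ofReal M)) =
      ENNReal.ofReal (nonlinL2Const ι * M) := by
    rw [Fintype.card_prod, Fintype.card_prod, ← ENNReal.ofReal_natCast, ← ENNReal.ofReal_ofNat 2,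
      ← ENNReal.ofReal_mul (by norm_num), ← ENNReal.ofReal_mul (by positivity),
      ← ENNReal.ofReal_mul hc₀0]
    congr 1
    rw [hc₀, nonlinL2Const]; push_cast; ring
  calc eLpNorm (nonlin v v) 2 volume
      ≤ eLpNorm (fun ξ => c₀ * ∑ σ, G σ ξ) 2 volume := eLpNorm_mono_real hpt
    _ = ENNReal.ofReal c₀ * eLpNorm (fun ξ => ∑ σ, G σ ξ) 2 volume := by
        rw [show (fun ξ => c₀ * ∑ σ, G σ ξ) = c₀ • fun ξ => ∑ σ, G σ ξ from rfl,
          eLpNorm_const_smul, Real.enorm_eq_ofReal hc₀0]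
    _ ≤ ENNReal.ofReal c₀ * ((Fintype.card (ι × ι × ι) : ℝ≥0∞) * (2 * (ENNReal.ofReal M * W))) := by
        gcongr
    _ = ENNReal.ofReal c₀ * ((Fintype.card (ι × ι × ι) : ℝ≥0∞) * (2 * ENNReal.ofReal M)) * W := by
        ring
    _ = ENNReal.ofReal (nonlinL2Const ι * M) * W := by rw [hconst]

end Nonlin

/-! ### Finiteness of the enstrophy along a mild solution -/

/-- `E(f) ≤ A² I` with `I = ∫⁻ (1+‖ξ‖)^{-K₀}`, for `f` with decay of order `K₀ + 1`. [folklore] -/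
theorem enst_le_of_hasDecay {A : ℝ} {f : EuclideanSpace ℝ ι → ι → ℂ} (hf : HasDecay (K₀ + 1) A f) :
    enst f ≤ ENNReal.ofReal (A ^ 2) *
      ∫⁻ ξ : EuclideanSpace ℝ ι, ENNReal.ofReal ((1 + ‖ξ‖) ^ K₀)⁻¹ := by
  have hA := hf.nonneg
  rw [enst, ← lintegral_const_mul' _ _ ENNReal.ofReal_ne_top]
  refine lintegral_mono fun ξ => ?_
  rw [← ENNReal.ofReal_mul (sq_nonneg A)]
  refine ENNReal.ofReal_le_ofReal ?_
  have hw : 0 < 1 + ‖ξ‖ := by positivity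
  have h1 : ‖ξ‖ * ‖f ξ‖ ≤ A * ((1 + ‖ξ‖) ^ K₀)⁻¹ := by
    calc ‖ξ‖ * ‖f ξ‖ ≤ (1 + ‖ξ‖) * (A * ((1 + ‖ξ‖) ^ (K₀ + 1))⁻¹) :=
          mul_le_mul (by linarith [norm_nonneg ξ]) (hf ξ) (norm_nonneg _) hw.le
      _ = A * ((1 + ‖ξ‖) ^ K₀)⁻¹ := by
          rw [pow_succ]; field_simp
  have h0 : 0 ≤ ‖ξ‖ * ‖f ξ‖ := by positivity
  calc ‖ξ‖ ^ 2 * ‖f ξ‖ ^ 2 = (‖ξ‖ * ‖f ξ‖) ^ 2 := by ring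
    _ ≤ (A * ((1 + ‖ξ‖) ^ K₀)⁻¹) ^ 2 := pow_le_pow_left₀ h0 h1 2
    _ = A ^ 2 * ((1 + ‖ξ‖) ^ K₀)⁻¹ * ((1 + ‖ξ‖) ^ K₀)⁻¹ := by ring
    _ ≤ A ^ 2 * ((1 + ‖ξ‖) ^ K₀)⁻¹ * 1 := by
        gcongr
        exact inv_one_add_norm_pow_le_one ξ K₀
    _ = A ^ 2 * ((1 + ‖ξ‖) ^ K₀)⁻¹ := mul_one _

/-- `∫⁻ (1+‖ξ‖)^{-K₀} < ∞` for `K₀ > card ι`. [folklore] -/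
theorem lintegral_inv_weight_lt_top (hK₀ : Fintype.card ι < K₀) :
    ∫⁻ ξ : EuclideanSpace ℝ ι, ENNReal.ofReal ((1 + ‖ξ‖) ^ K₀)⁻¹ < ⊤ :=
  (hasFiniteIntegral_iff_ofReal (Eventually.of_forall fun ξ => by positivity)).1
    (integrable_inv_one_add_norm_pow (E := EuclideanSpace ℝ ι) (finrank_lt_of_card_lt hK₀)).2

section Duhamel

variable [DecidableEq ι] {c t₀ t₁ : ℝ} {V : ℝ → EuclideanSpace ℝ ι → ι → ℂ}

/-- Along a mild solution the enstrophy is bounded uniformly in time (decay of order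
`K₀ + 1` uniformly in time). [folklore] -/
theorem IsFourierMild.exists_enst_le (h : IsFourierMild c K₀ t₀ t₁ V) :
    ∃ B : ℝ≥0∞, B < ⊤ ∧ ∀ r, enst (V r) ≤ B := by
  obtain ⟨A, hA⟩ := h.decay (K₀ + 1)
  exact ⟨_, ENNReal.mul_lt_top ENNReal.ofReal_lt_top (lintegral_inv_weight_lt_top h.hK₀),
    fun r => enst_le_of_hasDecay (hA r)⟩

/-! ### The Duhamel term: one derivative in `L^∞_t L²_ξ` -/

/-- **Pointwise bound of the Duhamel term**: for `s ≤ t`,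
`‖ξ‖² ‖∫ₛᵗ e^{-c‖ξ‖²(t-r)} N(V r, V r)(ξ) dr‖² ≤ (2c)⁻¹ ∫ₛᵗ ‖N(V r, V r)(ξ)‖² dr`
(Cauchy–Schwarz in time and `2c‖ξ‖² ∫ₛᵗ e^{-2c‖ξ‖²(t-r)} dr ≤ 1`; Lemarié-Rieusset 2016,
Lemma 7.2, (7.10)). [folklore] -/
theorem IsFourierMild.norm_sq_mul_norm_duhamel_sq_le (h : IsFourierMild c K₀ t₀ t₁ V) {s t : ℝ}
    (hst : s ≤ t) (ξ : EuclideanSpace ℝ ι) :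
    ‖ξ‖ ^ 2 * ‖∫ r in s..t, heat c ξ (t - r) • nonlin (V r) (V r) ξ‖ ^ 2 ≤
      (2 * c)⁻¹ * ∫ r in s..t, ‖nonlin (V r) (V r) ξ‖ ^ 2 := by
  have hc := h.hc
  set φ : ℝ → ℝ := fun r => ‖nonlin (V r) (V r) ξ‖ with hφ
  set k : ℝ → ℝ := fun r => heat c ξ (t - r) with hk
  have hφc : Continuous φ := (h.continuous_nonlin_time ξ).norm
  have hkc : Continuous k :=
    continuous_heat_comp c continuous_const (continuous_const.sub continuous_id)
  -- `‖D‖ ≤ ∫ k φ`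
  have h1 : ‖∫ r in s..t, heat c ξ (t - r) • nonlin (V r) (V r) ξ‖ ≤ ∫ r in s..t, k r * φ r := by
    refine (intervalIntegral.norm_integral_le_integral_norm hst).trans_eq ?_
    refine intervalIntegral.integral_congr fun r _ => ?_
    simp only [hk, hφ, norm_heat_smul]
  have h0 : 0 ≤ ∫ r in s..t, k r * φ r :=
    intervalIntegral.integral_nonneg hst fun r _ => mul_nonneg (heat_nonneg _ _ _) (norm_nonneg _)
  have h2 : (∫ r in s..t, k r * φ r) ^ 2 ≤ (∫ r in s..t, k r ^ 2) * ∫ r in s..t, φ r ^ 2 :=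
    sq_integral_mul_le hkc hφc hst
  have h3 : 2 * c * ‖ξ‖ ^ 2 * ∫ r in s..t, k r ^ 2 ≤ 1 :=
    two_mul_norm_sq_mul_integral_heat_sq_le c ξ s t
  have hφ0 : 0 ≤ ∫ r in s..t, φ r ^ 2 := intervalIntegral.integral_nonneg hst fun r _ => sq_nonneg _
  have h2c : 0 < 2 * c := by positivity
  calc ‖ξ‖ ^ 2 * ‖∫ r in s..t, heat c ξ (t - r) • nonlin (V r) (V r) ξ‖ ^ 2
      ≤ ‖ξ‖ ^ 2 * (∫ r in s..t, k r * φ r) ^ 2 := by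
        gcongr
    _ ≤ ‖ξ‖ ^ 2 * ((∫ r in s..t, k r ^ 2) * ∫ r in s..t, φ r ^ 2) := by gcongr
    _ = (2 * c)⁻¹ * ((2 * c * ‖ξ‖ ^ 2 * ∫ r in s..t, k r ^ 2) * ∫ r in s..t, φ r ^ 2) := by
        field_simp
    _ ≤ (2 * c)⁻¹ * (1 * ∫ r in s..t, φ r ^ 2) := by gcongr
    _ = (2 * c)⁻¹ * ∫ r in s..t, ‖nonlin (V r) (V r) ξ‖ ^ 2 := by rw [one_mul]

/-- **The Duhamel term in `L²_ξ`** (Tonelli):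
`∫ ‖ξ‖² ‖D(ξ)‖² dξ ≤ (2c)⁻¹ ∫ₛᵗ ‖N(V r, V r)‖²_{L²_ξ} dr`. [folklore] -/
theorem IsFourierMild.lintegral_duhamel_le (h : IsFourierMild c K₀ t₀ t₁ V) {s t : ℝ} (hst : s ≤ t) :
    ∫⁻ ξ, ENNReal.ofReal (‖ξ‖ ^ 2 * ‖∫ r in s..t, heat c ξ (t - r) • nonlin (V r) (V r) ξ‖ ^ 2) ≤
      ENNReal.ofReal ((2 * c)⁻¹) *
        ∫⁻ r in Ioc s t, eLpNorm (nonlin (V r) (V r)) 2 volume ^ 2 := by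
  have hc := h.hc
  have h2c : 0 ≤ (2 * c)⁻¹ := by positivity
  -- joint measurability of `(ξ, r) ↦ ofReal ‖N(V r, V r)(ξ)‖²`
  have hjoint : Continuous fun p : EuclideanSpace ℝ ι × ℝ => ‖nonlin (V p.2) (V p.2) p.1‖ ^ 2 :=
    ((h.continuous_nonlin.comp continuous_swap).norm).pow 2
  have hmeas : AEMeasurable (uncurry fun (ξ : EuclideanSpace ℝ ι) (r : ℝ) =>
      ENNReal.ofReal (‖nonlin (V r) (V r) ξ‖ ^ 2)) (volume.prod (volume.restrict (Ioc s t))) :=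
    (ENNReal.measurable_ofReal.comp hjoint.measurable).aemeasurable
  calc ∫⁻ ξ, ENNReal.ofReal (‖ξ‖ ^ 2 * ‖∫ r in s..t, heat c ξ (t - r) • nonlin (V r) (V r) ξ‖ ^ 2)
      ≤ ∫⁻ ξ, ENNReal.ofReal ((2 * c)⁻¹ * ∫ r in s..t, ‖nonlin (V r) (V r) ξ‖ ^ 2) :=
        lintegral_mono fun ξ => ENNReal.ofReal_le_ofReal (h.norm_sq_mul_norm_duhamel_sq_le hst ξ)
    _ = ∫⁻ ξ, ENNReal.ofReal ((2 * c)⁻¹) *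
          ∫⁻ r in Ioc s t, ENNReal.ofReal (‖nonlin (V r) (V r) ξ‖ ^ 2) := by
        refine lintegral_congr fun ξ => ?_
        have hφc : Continuous fun r => ‖nonlin (V r) (V r) ξ‖ ^ 2 :=
          ((h.continuous_nonlin_time ξ).norm).pow 2
        rw [ENNReal.ofReal_mul h2c, intervalIntegral.integral_of_le hst,
          ← ofReal_integral_eq_lintegral_ofReal
            ((hφc.integrableOn_Icc (a := s) (b := t)).mono_set Ioc_subset_Icc_self)
            (Eventually.of_forall fun r => sq_nonneg _)]
    _ = ENNReal.ofReal ((2 * c)⁻¹) *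
          ∫⁻ ξ, ∫⁻ r in Ioc s t, ENNReal.ofReal (‖nonlin (V r) (V r) ξ‖ ^ 2) :=
        lintegral_const_mul' _ _ ENNReal.ofReal_ne_top
    _ = ENNReal.ofReal ((2 * c)⁻¹) *
          ∫⁻ r in Ioc s t, ∫⁻ ξ, ENNReal.ofReal (‖nonlin (V r) (V r) ξ‖ ^ 2) := by
        rw [lintegral_lintegral_swap hmeas]
    _ = ENNReal.ofReal ((2 * c)⁻¹) *
          ∫⁻ r in Ioc s t, eLpNorm (nonlin (V r) (V r)) 2 volume ^ 2 := by
        congr 1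
        refine lintegral_congr fun r => ?_
        rw [eLpNorm_two_sq]
        refine lintegral_congr fun ξ => ?_
        rw [← ofReal_norm, ENNReal.ofReal_pow (norm_nonneg _)]

/-! ### The enstrophy bound -/

/-- The squared `L²` norm of the nonlinearity along the solution:
`‖N(V r, V r)‖²_{L²} ≤ (C_ι M)² E(V r)` for `r ∈ [t₀, t₁]`. [folklore] -/
theorem IsFourierMild.eLpNorm_nonlin_sq_le (h : IsFourierMild c K₀ t₀ t₁ V) {M : ℝ} (hM0 : 0 ≤ M)
    (hM : ∀ t ∈ Icc t₀ t₁, ∀ x l, ‖𝓕 (fun ξ => V t ξ l) x‖ ≤ M) {r : ℝ} (hr : r ∈ Icc t₀ t₁) :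
    eLpNorm (nonlin (V r) (V r)) 2 volume ^ 2 ≤
      ENNReal.ofReal ((nonlinL2Const ι * M) ^ 2) * enst (V r) := by
  obtain ⟨A, hA⟩ := h.decay (1 + K₀)
  have h1 := eLpNorm_nonlin_le h.hK₀ (h.continuous_slice r) (hA r) (hM r hr)
  calc eLpNorm (nonlin (V r) (V r)) 2 volume ^ 2
      ≤ (ENNReal.ofReal (nonlinL2Const ι * M) * eLpNorm (fun ξ => ‖ξ‖ * ‖V r ξ‖) 2 volume) ^ 2 :=
        pow_le_pow_left' h1 2
    _ = ENNReal.ofReal ((nonlinL2Const ι * M) ^ 2) * enst (V r) := by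
        rw [mul_pow, enst_eq_eLpNorm_sq, ENNReal.ofReal_pow (mul_nonneg nonlinL2Const_nonneg hM0)]

/-- Integrated form: `∫_{(s,t]} ‖N(V r, V r)‖²_{L²} dr ≤ (C_ι M)² S (t - s)` when `E(V) ≤ S` on
`[s, t] ⊆ [t₀, t₁]`. [folklore] -/
theorem IsFourierMild.lintegral_Ioc_eLpNorm_nonlin_sq_le (h : IsFourierMild c K₀ t₀ t₁ V) {M : ℝ}
    (hM0 : 0 ≤ M) (hM : ∀ t ∈ Icc t₀ t₁, ∀ x l, ‖𝓕 (fun ξ => V t ξ l) x‖ ≤ M) {s t : ℝ}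
    (hs : t₀ ≤ s) (ht : t ≤ t₁) {S : ℝ≥0∞} (hS : ∀ r ∈ Icc s t, enst (V r) ≤ S) :
    ∫⁻ r in Ioc s t, eLpNorm (nonlin (V r) (V r)) 2 volume ^ 2 ≤
      ENNReal.ofReal ((nonlinL2Const ι * M) ^ 2) * S * ENNReal.ofReal (t - s) := by
  calc ∫⁻ r in Ioc s t, eLpNorm (nonlin (V r) (V r)) 2 volume ^ 2
      ≤ ∫⁻ _r in Ioc s t, ENNReal.ofReal ((nonlinL2Const ι * M) ^ 2) * S := by
        refine setLIntegral_mono' measurableSet_Ioc fun r hr => ?_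
        have hrI : r ∈ Icc s t := ⟨hr.1.le, hr.2⟩
        exact (h.eLpNorm_nonlin_sq_le hM0 hM ⟨hs.trans hrI.1, hrI.2.trans ht⟩).trans
          (by gcongr; exact hS r hrI)
    _ = ENNReal.ofReal ((nonlinL2Const ι * M) ^ 2) * S * ENNReal.ofReal (t - s) := by
        rw [setLIntegral_const, Real.volume_Ioc]

/-- **The enstrophy inequality in mild form.** For a Fourier-side mild solution `V` on
`[t₀, t₁]` with bounded synthesis `|𝓕 V(r)ₗ| ≤ M` and `t₀ ≤ s ≤ t ≤ t₁`:
`E(V(t)) ≤ 2 E(V(s)) + (C_ι M)² (t - s) c⁻¹ S` whenever `E(V(r)) ≤ S` on `[s, t]`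
(`V(t) = e^{-c‖ξ‖²(t-s)}V(s) - D`, `|heat| ≤ 1`, `(a+b)² ≤ 2a² + 2b²`, the Duhamel bound in
`L²_ξ` and `‖N(V, V)‖_{L²} ≤ C_ι M E(V)^{1/2}`; Lemarié-Rieusset 2016, Thm. 11.2,
`(p, q) = (2, ∞)`, in the mild formulation of Thm. 7.2). [folklore] -/
theorem IsFourierMild.enst_le (h : IsFourierMild c K₀ t₀ t₁ V) {M : ℝ} (hM0 : 0 ≤ M)
    (hM : ∀ t ∈ Icc t₀ t₁, ∀ x l, ‖𝓕 (fun ξ => V t ξ l) x‖ ≤ M) {s t : ℝ} (hs : t₀ ≤ s)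
    (hst : s ≤ t) (ht : t ≤ t₁) {S : ℝ≥0∞} (hS : ∀ r ∈ Icc s t, enst (V r) ≤ S) :
    enst (V t) ≤ 2 * enst (V s) + ENNReal.ofReal ((nonlinL2Const ι * M) ^ 2 * (t - s) / c) * S := by
  have hc := h.hc
  set D : EuclideanSpace ℝ ι → ι → ℂ := fun ξ =>
    ∫ r in s..t, heat c ξ (t - r) • nonlin (V r) (V r) ξ with hD
  -- pointwise: `‖ξ‖²‖V t ξ‖² ≤ 2‖ξ‖²‖V s ξ‖² + 2‖ξ‖²‖D ξ‖²`
  have hpt : ∀ ξ, ‖ξ‖ ^ 2 * ‖V t ξ‖ ^ 2 ≤ 2 * (‖ξ‖ ^ 2 * ‖V s ξ‖ ^ 2) + 2 * (‖ξ‖ ^ 2 * ‖D ξ‖ ^ 2) := by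
    intro ξ
    have hVt : V t ξ = heat c ξ (t - s) • V s ξ - D ξ := h.duhamel hs hst ht ξ
    have hn : ‖V t ξ‖ ≤ ‖V s ξ‖ + ‖D ξ‖ := by
      rw [hVt]
      calc ‖heat c ξ (t - s) • V s ξ - D ξ‖ ≤ ‖heat c ξ (t - s) • V s ξ‖ + ‖D ξ‖ := norm_sub_le _ _
        _ ≤ ‖V s ξ‖ + ‖D ξ‖ := by
            rw [norm_heat_smul]
            gcongr
            exact mul_le_of_le_one_left (norm_nonneg _) (heat_le_one hc.le (by linarith) ξ)
    have hsq : ‖V t ξ‖ ^ 2 ≤ 2 * ‖V s ξ‖ ^ 2 + 2 * ‖D ξ‖ ^ 2 := by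
      nlinarith [norm_nonneg (V t ξ), norm_nonneg (V s ξ), norm_nonneg (D ξ),
        sq_nonneg (‖V s ξ‖ - ‖D ξ‖)]
    nlinarith [sq_nonneg ‖ξ‖]
  -- assemble
  have hmeas1 : Measurable fun ξ : EuclideanSpace ℝ ι => 2 * ENNReal.ofReal (‖ξ‖ ^ 2 * ‖V s ξ‖ ^ 2) :=
    (ENNReal.measurable_ofReal.comp ((continuous_norm.pow 2).mul
      ((h.continuous_slice s).norm.pow 2)).measurable).const_mul _
  calc enst (V t) = ∫⁻ ξ, ENNReal.ofReal (‖ξ‖ ^ 2 * ‖V t ξ‖ ^ 2) := rfl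
    _ ≤ ∫⁻ ξ, (2 * ENNReal.ofReal (‖ξ‖ ^ 2 * ‖V s ξ‖ ^ 2) +
          2 * ENNReal.ofReal (‖ξ‖ ^ 2 * ‖D ξ‖ ^ 2)) := by
        refine lintegral_mono fun ξ => ?_
        refine (ENNReal.ofReal_le_ofReal (hpt ξ)).trans_eq ?_
        rw [ENNReal.ofReal_add (by positivity) (by positivity), ENNReal.ofReal_mul zero_le_two,
          ENNReal.ofReal_mul zero_le_two, ENNReal.ofReal_ofNat]
    _ = 2 * enst (V s) + 2 * ∫⁻ ξ, ENNReal.ofReal (‖ξ‖ ^ 2 * ‖D ξ‖ ^ 2) := by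
        rw [lintegral_add_left hmeas1, lintegral_const_mul' _ _ ENNReal.ofNat_ne_top,
          lintegral_const_mul' _ _ ENNReal.ofNat_ne_top]
        rfl
    _ ≤ 2 * enst (V s) + 2 * (ENNReal.ofReal ((2 * c)⁻¹) *
          ∫⁻ r in Ioc s t, eLpNorm (nonlin (V r) (V r)) 2 volume ^ 2) := by
        gcongr
        exact h.lintegral_duhamel_le hst
    _ ≤ 2 * enst (V s) + 2 * (ENNReal.ofReal ((2 * c)⁻¹) *
          (ENNReal.ofReal ((nonlinL2Const ι * M) ^ 2) * S * ENNReal.ofReal (t - s))) := by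
        gcongr 2 * enst (V s) + 2 * (ENNReal.ofReal ((2 * c)⁻¹) * ?_)
        exact h.lintegral_Ioc_eLpNorm_nonlin_sq_le hM0 hM hs ht hS
    _ = 2 * enst (V s) + ENNReal.ofReal ((nonlinL2Const ι * M) ^ 2 * (t - s) / c) * S := by
        congr 1
        have e : ENNReal.ofReal ((nonlinL2Const ι * M) ^ 2 * (t - s) / c) =
            2 * ENNReal.ofReal ((2 * c)⁻¹) * ENNReal.ofReal ((nonlinL2Const ι * M) ^ 2) *
              ENNReal.ofReal (t - s) := by
          rw [← ENNReal.ofReal_ofNat 2, ← ENNReal.ofReal_mul zero_le_two,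
            ← ENNReal.ofReal_mul (by positivity), ← ENNReal.ofReal_mul (by positivity)]
          congr 1
          field_simp
        rw [e]
        ring

/-- **Doubling on short windows.** If `(C_ι M)² (t - s) ≤ c/2` then `E(V(r)) ≤ 4 E(V(s))` for
all `r ∈ [s, t]` (the supremum over the window is finite a priori and is absorbed). [folklore] -/
theorem IsFourierMild.enst_le_four_mul (h : IsFourierMild c K₀ t₀ t₁ V) {M : ℝ} (hM0 : 0 ≤ M)
    (hM : ∀ t ∈ Icc t₀ t₁, ∀ x l, ‖𝓕 (fun ξ => V t ξ l) x‖ ≤ M) {s t : ℝ} (hs : t₀ ≤ s)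
    (ht : t ≤ t₁) (hsmall : (nonlinL2Const ι * M) ^ 2 * (t - s) / c ≤ 1 / 2) :
    ∀ r ∈ Icc s t, enst (V r) ≤ 4 * enst (V s) := by
  have hc := h.hc
  obtain ⟨B, hBtop, hB⟩ := h.exists_enst_le
  set S : ℝ≥0∞ := ⨆ r ∈ Icc s t, enst (V r) with hSdef
  have hSle : ∀ r ∈ Icc s t, enst (V r) ≤ S := fun r hr => le_iSup₂ (f := fun r _ => enst (V r)) r hr
  have hStop : S ≠ ⊤ := ne_top_of_le_ne_top hBtop.ne (iSup₂_le fun r _ => hB r)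
  -- every value on the window is at most `2 E(V s) + S/2`
  have hhalf : ENNReal.ofReal (1 / 2) * S = S / 2 := by
    rw [one_div, ENNReal.ofReal_inv_of_pos two_pos, ENNReal.ofReal_ofNat, ENNReal.div_eq_inv_mul]
  have hwin : ∀ r ∈ Icc s t, enst (V r) ≤ 2 * enst (V s) + S / 2 := by
    intro r hr
    have h1 := h.enst_le hM0 hM hs hr.1 (hr.2.trans ht) (S := S)
      (fun r' hr' => hSle r' ⟨hr'.1, hr'.2.trans hr.2⟩)
    refine h1.trans ?_
    rw [← hhalf]
    gcongr 2 * enst (V s) + ?_ * S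
    refine ENNReal.ofReal_le_ofReal ?_
    calc (nonlinL2Const ι * M) ^ 2 * (r - s) / c ≤ (nonlinL2Const ι * M) ^ 2 * (t - s) / c := by
          gcongr
          exact hr.2
      _ ≤ 1 / 2 := hsmall
  have hS : S ≤ 2 * enst (V s) + S / 2 := iSup₂_le hwin
  have hS2 : S / 2 ≤ 2 * enst (V s) := by
    have h2top : S / 2 ≠ ⊤ := ENNReal.div_ne_top hStop two_ne_zero
    refine ENNReal.le_of_add_le_add_right h2top ?_
    calc S / 2 + S / 2 = S := ENNReal.add_halves S
      _ ≤ 2 * enst (V s) + S / 2 := hS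
  intro r hr
  calc enst (V r) ≤ S := hSle r hr
    _ = S / 2 + S / 2 := (ENNReal.add_halves S).symm
    _ ≤ 2 * enst (V s) + 2 * enst (V s) := add_le_add hS2 hS2
    _ = 4 * enst (V s) := by ring

/-- **Iterated doubling**: with a window length `τ > 0` such that `(C_ι M)² τ ≤ c/2`,
`E(V(r)) ≤ 4ⁿ E(V(t₀))` for `r ∈ [t₀, t₁]` with `r ≤ t₀ + n τ`. [folklore] -/
theorem IsFourierMild.enst_le_pow (h : IsFourierMild c K₀ t₀ t₁ V) {M : ℝ} (hM0 : 0 ≤ M)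
    (hM : ∀ t ∈ Icc t₀ t₁, ∀ x l, ‖𝓕 (fun ξ => V t ξ l) x‖ ≤ M) {τ : ℝ} (hτ : 0 < τ)
    (hsmall : (nonlinL2Const ι * M) ^ 2 * τ / c ≤ 1 / 2) (n : ℕ) :
    ∀ r ∈ Icc t₀ t₁, r ≤ t₀ + n * τ → enst (V r) ≤ 4 ^ n * enst (V t₀) := by
  have hc := h.hc
  induction n with
  | zero =>
    intro r hr hrn
    have : r = t₀ := le_antisymm (by simpa using hrn) hr.1
    rw [this, pow_zero, one_mul]
  | succ n ih =>
    intro r hr hrn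
    by_cases hle : r ≤ t₀ + n * τ
    · calc enst (V r) ≤ 4 ^ n * enst (V t₀) := ih r hr hle
        _ ≤ 4 ^ (n + 1) * enst (V t₀) := by
            gcongr
            · norm_num
            · exact Nat.le_succ n
    · push Not at hle
      set s := t₀ + n * τ with hsdef
      have hs0 : t₀ ≤ s := by
        have : (0 : ℝ) ≤ n * τ := by positivity
        linarith
      have hsI : s ∈ Icc t₀ t₁ := ⟨hs0, hle.le.trans hr.2⟩
      have hrs : r - s ≤ τ := by
        have : t₀ + (n + 1 : ℕ) * τ = s + τ := by rw [hsdef]; push_cast; ring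
        linarith [hrn]
      have hsm : (nonlinL2Const ι * M) ^ 2 * (r - s) / c ≤ 1 / 2 :=
        le_trans (by gcongr) hsmall
      have h4 := h.enst_le_four_mul hM0 hM hs0 hr.2 hsm r ⟨hle.le, le_rfl⟩
      calc enst (V r) ≤ 4 * enst (V s) := h4
        _ ≤ 4 * (4 ^ n * enst (V t₀)) := by
            gcongr
            exact ih s hsI le_rfl
        _ = 4 ^ (n + 1) * enst (V t₀) := by rw [pow_succ]; ring

/-- **Uniform enstrophy bound on the whole interval**:
`E(V(r)) ≤ 4^{⌈(t₁ - t₀)/τ⌉} E(V(t₀))` for all `r ∈ [t₀, t₁]`, where `τ = c / (2 (C_ι M)² + 1)`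
obeys the window condition — the mild form of the Grönwall bound
`‖∇u(t)‖² ≤ ‖∇u(t₀)‖² e^{C M² (t - t₀)/ν}` (Lemarié-Rieusset 2016, Thm. 11.2). [folklore] -/
theorem IsFourierMild.enst_le_uniform (h : IsFourierMild c K₀ t₀ t₁ V) {M : ℝ} (hM0 : 0 ≤ M)
    (hM : ∀ t ∈ Icc t₀ t₁, ∀ x l, ‖𝓕 (fun ξ => V t ξ l) x‖ ≤ M) :
    ∀ r ∈ Icc t₀ t₁, enst (V r) ≤
      4 ^ ⌈(t₁ - t₀) / (c / (2 * (nonlinL2Const ι * M) ^ 2 + 1))⌉₊ * enst (V t₀) := by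
  have hc := h.hc
  set τ : ℝ := c / (2 * (nonlinL2Const ι * M) ^ 2 + 1) with hτ
  have hτpos : 0 < τ := by positivity
  have hsmall : (nonlinL2Const ι * M) ^ 2 * τ / c ≤ 1 / 2 := by
    rw [hτ, div_le_iff₀ hc]
    have hden : 0 < 2 * (nonlinL2Const ι * M) ^ 2 + 1 := by positivity
    rw [mul_div_assoc', div_le_iff₀ hden]
    nlinarith [sq_nonneg (nonlinL2Const ι * M)]
  intro r hr
  refine h.enst_le_pow hM0 hM hτpos hsmall _ r hr ?_
  have h1 : (t₁ - t₀) / τ ≤ ⌈(t₁ - t₀) / τ⌉₊ := Nat.le_ceil _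
  rw [div_le_iff₀ hτpos] at h1
  linarith [hr.2]

/-! ### The Duhamel term: two derivatives in `L²_t L²_ξ` (the dissipation bound) -/

omit [DecidableEq ι] [Fintype ι] in
/-- **Weighted Cauchy–Schwarz for interval integrals**: for continuous `k ≥ 0` and `φ`,
`(∫ₐᵇ k φ)² ≤ (∫ₐᵇ k)(∫ₐᵇ k φ²)` (`a ≤ b`; discriminant of `x ↦ ∫ k (x - φ)² ≥ 0`). [folklore] -/
theorem sq_integral_mul_le_weighted {k φ : ℝ → ℝ} (hk : Continuous k) (hφ : Continuous φ)
    (hk0 : ∀ x, 0 ≤ k x) {a b : ℝ} (hab : a ≤ b) :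
    (∫ x in a..b, k x * φ x) ^ 2 ≤ (∫ x in a..b, k x) * ∫ x in a..b, k x * φ x ^ 2 := by
  have hi : ∀ {ψ : ℝ → ℝ}, Continuous ψ → IntervalIntegrable ψ volume a b := fun hψ =>
    hψ.intervalIntegrable _ _
  have hq : ∀ x : ℝ, 0 ≤ (∫ t in a..b, k t) * (x * x) + (-2 * ∫ t in a..b, k t * φ t) * x +
      ∫ t in a..b, k t * φ t ^ 2 := by
    intro x
    have h0 : 0 ≤ ∫ t in a..b, k t * (x - φ t) ^ 2 :=
      intervalIntegral.integral_nonneg hab fun t _ => mul_nonneg (hk0 t) (sq_nonneg _)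
    have hexp : ∫ t in a..b, k t * (x - φ t) ^ 2 =
        (∫ t in a..b, k t) * (x * x) + (-2 * ∫ t in a..b, k t * φ t) * x +
          ∫ t in a..b, k t * φ t ^ 2 := by
      have e1 : (fun t => k t * (x - φ t) ^ 2) =
          fun t => (x * x) * k t + (-2 * x) * (k t * φ t) + k t * φ t ^ 2 := by
        funext t; ring
      rw [e1, intervalIntegral.integral_add ((hi (by fun_prop)).add (hi (by fun_prop)))
        (hi (by fun_prop)), intervalIntegral.integral_add (hi (by fun_prop)) (hi (by fun_prop)),
        intervalIntegral.integral_const_mul, intervalIntegral.integral_const_mul]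
      ring
    rw [← hexp]; exact h0
  have hd := discrim_le_zero hq
  rw [discrim] at hd
  nlinarith [hd]

omit [DecidableEq ι] [Fintype ι] in
/-- `c‖ξ‖² ∫ₛʳ e^{-c‖ξ‖²(r-r')} dr' ≤ 1` (`= 1 - e^{-c‖ξ‖²(r-s)}`). [folklore] -/
theorem mul_norm_sq_mul_integral_heat_le {E : Type*} [NormedAddCommGroup E] (c : ℝ) (ξ : E)
    (s r : ℝ) : c * ‖ξ‖ ^ 2 * ∫ r' in s..r, heat c ξ (r - r') ≤ 1 := by
  set β : ℝ := c * ‖ξ‖ ^ 2 with hβ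
  have hh : ∀ r', heat c ξ (r - r') = Real.exp (β * r' - β * r) := fun r' => by
    rw [heat, hβ]; congr 1; ring
  have hderiv : ∀ x, HasDerivAt (fun x => Real.exp (β * x - β * r))
      (β * Real.exp (β * x - β * r)) x := by
    intro x
    have h1 : HasDerivAt (fun x => β * x - β * r) (β * 1) x :=
      ((hasDerivAt_id x).const_mul β).sub_const (β * r)
    have h2 := h1.exp
    rw [mul_one] at h2
    simpa [mul_comm] using h2
  have hFTC : ∫ x in s..r, β * Real.exp (β * x - β * r) =
      Real.exp (β * r - β * r) - Real.exp (β * s - β * r) :=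
    intervalIntegral.integral_eq_sub_of_hasDerivAt (fun x _ => hderiv x)
      ((Continuous.intervalIntegrable (by fun_prop)) _ _)
  calc β * ∫ r' in s..r, heat c ξ (r - r') = ∫ x in s..r, β * Real.exp (β * x - β * r) := by
        rw [← intervalIntegral.integral_const_mul]
        exact intervalIntegral.integral_congr fun x _ => by rw [hh]
    _ = 1 - Real.exp (β * s - β * r) := by rw [hFTC]; simp
    _ ≤ 1 := by linarith [Real.exp_pos (β * s - β * r)]

omit [DecidableEq ι] [Fintype ι] in
/-- `c‖ξ‖² ∫_{r'}ᵗ e^{-c‖ξ‖²(r-r')} dr ≤ 1` (integration in the later variable). [folklore] -/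
theorem mul_norm_sq_mul_integral_heat_le' {E : Type*} [NormedAddCommGroup E] {c : ℝ} (hc : 0 ≤ c)
    (ξ : E) (r' t : ℝ) : c * ‖ξ‖ ^ 2 * ∫ r in r'..t, heat c ξ (r - r') ≤ 1 := by
  set β : ℝ := c * ‖ξ‖ ^ 2 with hβ
  have hβ0 : 0 ≤ β := by positivity
  have hh : ∀ r, heat c ξ (r - r') = Real.exp (-(β * r - β * r')) := fun r => by
    rw [heat, hβ]; congr 1; ring
  have hderiv : ∀ x, HasDerivAt (fun x => -Real.exp (-(β * x - β * r')))
      (β * Real.exp (-(β * x - β * r'))) x := by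
    intro x
    have h1 : HasDerivAt (fun x => -(β * x - β * r')) (-(β * 1)) x :=
      (((hasDerivAt_id x).const_mul β).sub_const (β * r')).neg
    have h2 := h1.exp.neg
    exact h2.congr_deriv (by ring)
  have hFTC : ∫ x in r'..t, β * Real.exp (-(β * x - β * r')) =
      -Real.exp (-(β * t - β * r')) - -Real.exp (-(β * r' - β * r')) :=
    intervalIntegral.integral_eq_sub_of_hasDerivAt (fun x _ => hderiv x)
      ((Continuous.intervalIntegrable (by fun_prop)) _ _)
  calc β * ∫ r in r'..t, heat c ξ (r - r') = ∫ x in r'..t, β * Real.exp (-(β * x - β * r')) := by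
        rw [← intervalIntegral.integral_const_mul]
        exact intervalIntegral.integral_congr fun x _ => by rw [hh]
    _ = 1 - Real.exp (-(β * t - β * r')) := by
        rw [hFTC, sub_self (β * r'), neg_zero, Real.exp_zero]; ring
    _ ≤ 1 := by linarith [Real.exp_pos (-(β * t - β * r'))]

omit [DecidableEq ι] [Fintype ι] in
/-- `2c‖ξ‖² ∫ₛᵗ e^{-2c‖ξ‖²(r-s)} dr ≤ 1` (the free heat flow gains one derivative in `L²_t`;
Lemarié-Rieusset 2016, Lemma 7.1, (7.9)). [folklore] -/
theorem two_mul_norm_sq_mul_integral_heat_sq_le' {E : Type*} [NormedAddCommGroup E] {c : ℝ}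
    (hc : 0 ≤ c) (ξ : E) (s t : ℝ) :
    2 * c * ‖ξ‖ ^ 2 * ∫ r in s..t, heat c ξ (r - s) ^ 2 ≤ 1 := by
  have hsq : ∀ r, heat c ξ (r - s) ^ 2 = heat (2 * c) ξ (r - s) := fun r => by
    rw [heat, heat, ← Real.exp_nat_mul]; congr 1; push_cast; ring
  have := mul_norm_sq_mul_integral_heat_le' (c := 2 * c) (by positivity) ξ s t
  calc 2 * c * ‖ξ‖ ^ 2 * ∫ r in s..t, heat c ξ (r - s) ^ 2
      = 2 * c * ‖ξ‖ ^ 2 * ∫ r in s..t, heat (2 * c) ξ (r - s) := by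
        congr 1; exact intervalIntegral.integral_congr fun r _ => hsq r
    _ ≤ 1 := this

/-- **Pointwise bound of the Duhamel term, second form**: for `s ≤ r`,
`‖ξ‖⁴ ‖∫ₛʳ e^{-c‖ξ‖²(r-r')} N(V r', V r')(ξ) dr'‖² ≤ c⁻¹ ∫ₛʳ ‖ξ‖² e^{-c‖ξ‖²(r-r')} ‖N(V r', V r')(ξ)‖² dr'`
(weighted Cauchy–Schwarz with the heat weight, whose mass is `≤ (c‖ξ‖²)⁻¹`;
Lemarié-Rieusset 2016, Lemma 7.2, (7.11)). [folklore] -/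
theorem IsFourierMild.norm_pow_four_mul_norm_duhamel_sq_le (h : IsFourierMild c K₀ t₀ t₁ V)
    {s r : ℝ} (hsr : s ≤ r) (ξ : EuclideanSpace ℝ ι) :
    ‖ξ‖ ^ 4 * ‖∫ r' in s..r, heat c ξ (r - r') • nonlin (V r') (V r') ξ‖ ^ 2 ≤
      c⁻¹ * ∫ r' in s..r, ‖ξ‖ ^ 2 * heat c ξ (r - r') * ‖nonlin (V r') (V r') ξ‖ ^ 2 := by
  have hc := h.hc
  set φ : ℝ → ℝ := fun r' => ‖nonlin (V r') (V r') ξ‖ with hφ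
  set k : ℝ → ℝ := fun r' => ‖ξ‖ ^ 2 * heat c ξ (r - r') with hk
  have hφc : Continuous φ := (h.continuous_nonlin_time ξ).norm
  have hkc : Continuous k :=
    continuous_const.mul (continuous_heat_comp c continuous_const (continuous_const.sub continuous_id))
  have hk0 : ∀ x, 0 ≤ k x := fun x => mul_nonneg (sq_nonneg _) (heat_nonneg _ _ _)
  have h1 : ‖ξ‖ ^ 2 * ‖∫ r' in s..r, heat c ξ (r - r') • nonlin (V r') (V r') ξ‖ ≤
      ∫ r' in s..r, k r' * φ r' := by
    calc ‖ξ‖ ^ 2 * ‖∫ r' in s..r, heat c ξ (r - r') • nonlin (V r') (V r') ξ‖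
        ≤ ‖ξ‖ ^ 2 * ∫ r' in s..r, ‖heat c ξ (r - r') • nonlin (V r') (V r') ξ‖ := by
          gcongr; exact intervalIntegral.norm_integral_le_integral_norm hsr
      _ = ∫ r' in s..r, k r' * φ r' := by
          rw [← intervalIntegral.integral_const_mul]
          refine intervalIntegral.integral_congr fun r' _ => ?_
          simp only [hk, hφ, norm_heat_smul, mul_assoc]
  have h0 : 0 ≤ ∫ r' in s..r, k r' * φ r' :=
    intervalIntegral.integral_nonneg hsr fun r' _ => mul_nonneg (hk0 r') (norm_nonneg _)
  have h2 := sq_integral_mul_le_weighted hkc hφc hk0 hsr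
  have h3 : c * ∫ r' in s..r, k r' ≤ 1 := by
    have := mul_norm_sq_mul_integral_heat_le c ξ s r
    rwa [hk, intervalIntegral.integral_const_mul, ← mul_assoc]
  have hkφ0 : 0 ≤ ∫ r' in s..r, k r' * φ r' ^ 2 :=
    intervalIntegral.integral_nonneg hsr fun r' _ => mul_nonneg (hk0 r') (sq_nonneg _)
  have hpos : 0 ≤ ‖ξ‖ ^ 2 * ‖∫ r' in s..r, heat c ξ (r - r') • nonlin (V r') (V r') ξ‖ := by
    positivity
  calc ‖ξ‖ ^ 4 * ‖∫ r' in s..r, heat c ξ (r - r') • nonlin (V r') (V r') ξ‖ ^ 2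
      = (‖ξ‖ ^ 2 * ‖∫ r' in s..r, heat c ξ (r - r') • nonlin (V r') (V r') ξ‖) ^ 2 := by ring
    _ ≤ (∫ r' in s..r, k r' * φ r') ^ 2 := pow_le_pow_left₀ hpos h1 2
    _ ≤ (∫ r' in s..r, k r') * ∫ r' in s..r, k r' * φ r' ^ 2 := h2
    _ = c⁻¹ * ((c * ∫ r' in s..r, k r') * ∫ r' in s..r, k r' * φ r' ^ 2) := by field_simp
    _ ≤ c⁻¹ * (1 * ∫ r' in s..r, k r' * φ r' ^ 2) := by gcongr
    _ = c⁻¹ * ∫ r' in s..r, ‖ξ‖ ^ 2 * heat c ξ (r - r') * ‖nonlin (V r') (V r') ξ‖ ^ 2 := by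
        rw [one_mul]

/-- **The Duhamel term at a fixed frequency in `L²_t`** (Young's inequality in time, done by
Tonelli on the triangle `s < r' ≤ r ≤ t`):
`∫ₛᵗ ‖ξ‖⁴ ‖D_r(ξ)‖² dr ≤ c⁻² ∫ₛᵗ ‖N(V r', V r')(ξ)‖² dr'` (Lemarié-Rieusset 2016, Lemma 7.2,
(7.11): `‖Δ ∫₀ᵗ e^{ν(t-s)Δ} f ds‖_{L²L²} ≤ ν⁻¹ ‖f‖_{L²L²}`). [folklore] -/
theorem IsFourierMild.lintegral_Ioc_duhamel_le (h : IsFourierMild c K₀ t₀ t₁ V) (s t : ℝ)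
    (ξ : EuclideanSpace ℝ ι) :
    ∫⁻ r in Ioc s t, ENNReal.ofReal
        (‖ξ‖ ^ 4 * ‖∫ r' in s..r, heat c ξ (r - r') • nonlin (V r') (V r') ξ‖ ^ 2) ≤
      ENNReal.ofReal (c⁻¹ ^ 2) * ∫⁻ r' in Ioc s t, ENNReal.ofReal (‖nonlin (V r') (V r') ξ‖ ^ 2) := by
  have hc := h.hc
  have hci : 0 ≤ c⁻¹ := by positivity
  set φ : ℝ → ℝ := fun r' => ‖nonlin (V r') (V r') ξ‖ with hφ
  have hφc : Continuous φ := (h.continuous_nonlin_time ξ).norm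
  -- the kernel on the triangle
  set W : ℝ → ℝ → ℝ := fun r r' => ‖ξ‖ ^ 2 * heat c ξ (r - r') with hW
  have hWc : Continuous (uncurry W) :=
    continuous_const.mul (continuous_heat_comp c continuous_const (continuous_fst.sub continuous_snd))
  have hW0 : ∀ r r', 0 ≤ W r r' := fun r r' => mul_nonneg (sq_nonneg _) (heat_nonneg _ _ _)
  set G : ℝ → ℝ → ℝ≥0∞ := fun r r' => ENNReal.ofReal (W r r' * φ r' ^ 2) with hG
  have hGm : Measurable (uncurry G) :=
    ENNReal.measurable_ofReal.comp (hWc.mul ((hφc.pow 2).comp continuous_snd)).measurable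
  set H : ℝ → ℝ → ℝ≥0∞ := fun r r' => {p : ℝ × ℝ | p.2 ≤ p.1}.indicator (uncurry G) (r, r') with hH
  have hHm : Measurable (uncurry H) := by
    have : uncurry H = {p : ℝ × ℝ | p.2 ≤ p.1}.indicator (uncurry G) := by
      funext p; rfl
    rw [this]
    exact hGm.indicator (measurableSet_le measurable_snd measurable_fst)
  -- (a) pointwise in `r`
  have ha : ∀ r ∈ Ioc s t, ENNReal.ofReal
      (‖ξ‖ ^ 4 * ‖∫ r' in s..r, heat c ξ (r - r') • nonlin (V r') (V r') ξ‖ ^ 2) ≤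
        ENNReal.ofReal c⁻¹ * ∫⁻ r' in Ioc s t, H r r' := by
    intro r hr
    have h1 := h.norm_pow_four_mul_norm_duhamel_sq_le hr.1.le ξ
    refine (ENNReal.ofReal_le_ofReal h1).trans_eq ?_
    rw [ENNReal.ofReal_mul hci, intervalIntegral.integral_of_le hr.1.le,
      ofReal_integral_eq_lintegral_ofReal]
    · congr 1
      -- `∫⁻ over Ioc s r` as an integral over `Ioc s t` with the indicator
      have hset : Iic r ∩ Ioc s t = Ioc s r := by
        ext x
        simp only [mem_inter_iff, mem_Iic, mem_Ioc]
        constructor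
        · rintro ⟨hxr, hsx, -⟩; exact ⟨hsx, hxr⟩
        · rintro ⟨hsx, hxr⟩; exact ⟨hxr, hsx, hxr.trans hr.2⟩
      have hind : (fun r' => H r r') = (Iic r).indicator (fun r' => G r r') := by
        funext r'
        simp only [hH, Set.indicator_apply, mem_setOf_eq, mem_Iic, uncurry]
      rw [hind, lintegral_indicator measurableSet_Iic, Measure.restrict_restrict measurableSet_Iic,
        hset]
    · exact ((hWc.comp (Continuous.prodMk_right r)).mul (hφc.pow 2)).integrableOn_Icc.mono_set
        Ioc_subset_Icc_self
    · exact Eventually.of_forall fun r' => mul_nonneg (hW0 r r') (sq_nonneg _)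
  -- (b) the inner integral after Tonelli
  have hb : ∀ r' ∈ Ioc s t, ∫⁻ r in Ioc s t, H r r' ≤
      ENNReal.ofReal c⁻¹ * ENNReal.ofReal (φ r' ^ 2) := by
    intro r' hr'
    have hind : (fun r => H r r') =
        (Ici r').indicator (fun r => ENNReal.ofReal (φ r' ^ 2) * ENNReal.ofReal (W r r')) := by
      funext r
      simp only [hH, hG, Set.indicator_apply, mem_setOf_eq, mem_Ici, uncurry]
      split_ifs
      · rw [ENNReal.ofReal_mul (hW0 r r'), mul_comm]
      · rfl
    rw [hind, lintegral_indicator measurableSet_Ici, Measure.restrict_restrict measurableSet_Ici,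
      lintegral_const_mul' _ _ ENNReal.ofReal_ne_top, mul_comm]
    gcongr
    calc ∫⁻ r in Ici r' ∩ Ioc s t, ENNReal.ofReal (W r r')
        ≤ ∫⁻ r in Icc r' t, ENNReal.ofReal (W r r') :=
          lintegral_mono_set fun r ⟨h1, h2⟩ => ⟨h1, h2.2⟩
      _ = ENNReal.ofReal (∫ r in r'..t, W r r') := by
          rw [intervalIntegral.integral_of_le hr'.2, ← integral_Icc_eq_integral_Ioc,
            ofReal_integral_eq_lintegral_ofReal]
          · exact ((hWc.comp (Continuous.prodMk_left r')).integrableOn_Icc)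
          · exact Eventually.of_forall fun r => hW0 r r'
      _ ≤ ENNReal.ofReal c⁻¹ := by
          refine ENNReal.ofReal_le_ofReal ?_
          have h3 : c * ∫ r in r'..t, W r r' ≤ 1 := by
            have := mul_norm_sq_mul_integral_heat_le' hc.le ξ r' t
            rwa [hW, intervalIntegral.integral_const_mul, ← mul_assoc]
          have := (le_div_iff₀' hc).2 h3
          rwa [one_div] at this
  -- (c) assemble: Tonelli on the square `Ioc s t × Ioc s t`
  calc ∫⁻ r in Ioc s t, ENNReal.ofReal
        (‖ξ‖ ^ 4 * ‖∫ r' in s..r, heat c ξ (r - r') • nonlin (V r') (V r') ξ‖ ^ 2)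
      ≤ ∫⁻ r in Ioc s t, ENNReal.ofReal c⁻¹ * ∫⁻ r' in Ioc s t, H r r' :=
        setLIntegral_mono' measurableSet_Ioc ha
    _ = ENNReal.ofReal c⁻¹ * ∫⁻ r in Ioc s t, ∫⁻ r' in Ioc s t, H r r' :=
        lintegral_const_mul' _ _ ENNReal.ofReal_ne_top
    _ = ENNReal.ofReal c⁻¹ * ∫⁻ r' in Ioc s t, ∫⁻ r in Ioc s t, H r r' := by
        rw [lintegral_lintegral_swap hHm.aemeasurable]
    _ ≤ ENNReal.ofReal c⁻¹ * ∫⁻ r' in Ioc s t, ENNReal.ofReal c⁻¹ * ENNReal.ofReal (φ r' ^ 2) := by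
        gcongr ENNReal.ofReal c⁻¹ * ?_
        exact setLIntegral_mono' measurableSet_Ioc hb
    _ = ENNReal.ofReal (c⁻¹ ^ 2) * ∫⁻ r' in Ioc s t, ENNReal.ofReal (‖nonlin (V r') (V r') ξ‖ ^ 2) := by
        rw [lintegral_const_mul' _ _ ENNReal.ofReal_ne_top, ← mul_assoc, ← ENNReal.ofReal_mul hci, sq]

/-! ### The dissipation bound -/

omit [DecidableEq ι] in
/-- The Fourier-side `L²_t Ḣ²` dissipation on `(s, t]`:
`𝒟(V; s, t) = ∫ₛᵗ ∫ ‖ξ‖⁴ ‖V(r, ξ)‖² dξ dr` (`= (16π⁴)⁻¹ ∫ₛᵗ ‖Δu‖²_{L²}`). [folklore] -/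
def dissip (V : ℝ → EuclideanSpace ℝ ι → ι → ℂ) (s t : ℝ) : ℝ≥0∞ :=
  ∫⁻ r in Ioc s t, ∫⁻ ξ, ENNReal.ofReal (‖ξ‖ ^ 4 * ‖V r ξ‖ ^ 2)

/-- **The dissipation bound in mild form.** For a Fourier-side mild solution `V` on `[t₀, t₁]`
with bounded synthesis `|𝓕 V(r)ₗ| ≤ M`, `t₀ ≤ s ≤ t ≤ t₁` and `E(V) ≤ S` on `[s, t]`:
`𝒟(V; s, t) ≤ c⁻¹ E(V(s)) + 2 (C_ι M)² (t - s) c⁻² S` — the `L²_t Ḣ²` half of the enstrophy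
balance `ν ∫ ‖Δu‖² ≤ ‖∇u(s)‖² + ν⁻¹ ∫ ‖ℙ∇·(u⊗u)‖²` (Lemarié-Rieusset 2016, Thm. 11.2 /
Lemma 7.2: free part `(7.9)`, Duhamel part `(7.11)`, and `‖N‖_{L²} ≤ C_ι M E^{1/2}`). [folklore] -/
theorem IsFourierMild.dissip_le (h : IsFourierMild c K₀ t₀ t₁ V) {M : ℝ} (hM0 : 0 ≤ M)
    (hM : ∀ t ∈ Icc t₀ t₁, ∀ x l, ‖𝓕 (fun ξ => V t ξ l) x‖ ≤ M) {s t : ℝ} (hs : t₀ ≤ s)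
    (hst : s ≤ t) (ht : t ≤ t₁) {S : ℝ≥0∞} (hS : ∀ r ∈ Icc s t, enst (V r) ≤ S) :
    dissip V s t ≤ ENNReal.ofReal c⁻¹ * enst (V s) +
      ENNReal.ofReal (2 * (nonlinL2Const ι * M) ^ 2 * (t - s) / c ^ 2) * S := by
  have hc := h.hc
  have hci : 0 ≤ c⁻¹ := by positivity
  -- the Duhamel term from time `s`, jointly continuous in `(r, ξ)`
  set D : ℝ → EuclideanSpace ℝ ι → ι → ℂ := fun r ξ =>
    ∫ r' in s..r, heat c ξ (r - r') • nonlin (V r') (V r') ξ with hD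
  have hDc : Continuous (uncurry D) := by
    have hheat : Continuous fun q : (ℝ × EuclideanSpace ℝ ι) × ℝ => heat c q.1.2 (q.1.1 - q.2) :=
      continuous_heat_comp c (continuous_snd.comp continuous_fst)
        ((continuous_fst.comp continuous_fst).sub continuous_snd)
    have hN : Continuous fun q : (ℝ × EuclideanSpace ℝ ι) × ℝ => nonlin (V q.2) (V q.2) q.1.2 := by
      have e : (fun q : (ℝ × EuclideanSpace ℝ ι) × ℝ => nonlin (V q.2) (V q.2) q.1.2) =
          (fun p : ℝ × EuclideanSpace ℝ ι => nonlin (V p.1) (V p.1) p.2) ∘ fun q => (q.2, q.1.2) := rfl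
      rw [e]
      exact h.continuous_nonlin.comp (by fun_prop)
    have hF : Continuous fun q : (ℝ × EuclideanSpace ℝ ι) × ℝ =>
        heat c q.1.2 (q.1.1 - q.2) • nonlin (V q.2) (V q.2) q.1.2 := hheat.smul hN
    have h2 : Continuous fun p : ℝ × EuclideanSpace ℝ ι =>
        ∫ r' in s..p.1, heat c p.2 (p.1 - r') • nonlin (V r') (V r') p.2 :=
      intervalIntegral.continuous_parametric_intervalIntegral_of_continuous (a₀ := s) hF
        continuous_fst
    have hU : uncurry D = fun p : ℝ × EuclideanSpace ℝ ι =>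
        ∫ r' in s..p.1, heat c p.2 (p.1 - r') • nonlin (V r') (V r') p.2 := by
      funext p; rfl
    rw [hU]
    exact h2
  -- pointwise for `r ∈ (s, t]`
  have hpt : ∀ r ∈ Ioc s t, ∀ ξ, ‖ξ‖ ^ 4 * ‖V r ξ‖ ^ 2 ≤
      2 * (‖ξ‖ ^ 4 * (heat c ξ (r - s) ^ 2 * ‖V s ξ‖ ^ 2)) + 2 * (‖ξ‖ ^ 4 * ‖D r ξ‖ ^ 2) := by
    intro r hr ξ
    have hVr : V r ξ = heat c ξ (r - s) • V s ξ - D r ξ := h.duhamel hs hr.1.le (hr.2.trans ht) ξ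
    have hn : ‖V r ξ‖ ≤ heat c ξ (r - s) * ‖V s ξ‖ + ‖D r ξ‖ := by
      rw [hVr]; exact (norm_sub_le _ _).trans (by rw [norm_heat_smul])
    have h0 : 0 ≤ heat c ξ (r - s) * ‖V s ξ‖ := mul_nonneg (heat_nonneg _ _ _) (norm_nonneg _)
    have hsq : ‖V r ξ‖ ^ 2 ≤ 2 * (heat c ξ (r - s) ^ 2 * ‖V s ξ‖ ^ 2) + 2 * ‖D r ξ‖ ^ 2 := by
      nlinarith [norm_nonneg (V r ξ), norm_nonneg (D r ξ),
        sq_nonneg (heat c ξ (r - s) * ‖V s ξ‖ - ‖D r ξ‖)]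
    calc ‖ξ‖ ^ 4 * ‖V r ξ‖ ^ 2
        ≤ ‖ξ‖ ^ 4 * (2 * (heat c ξ (r - s) ^ 2 * ‖V s ξ‖ ^ 2) + 2 * ‖D r ξ‖ ^ 2) :=
          mul_le_mul_of_nonneg_left hsq (by positivity)
      _ = _ := by ring
  -- the free term at a fixed frequency
  have hfree : ∀ ξ : EuclideanSpace ℝ ι,
      ∫⁻ r in Ioc s t, ENNReal.ofReal (‖ξ‖ ^ 4 * (heat c ξ (r - s) ^ 2 * ‖V s ξ‖ ^ 2)) ≤
        ENNReal.ofReal ((2 * c)⁻¹) * ENNReal.ofReal (‖ξ‖ ^ 2 * ‖V s ξ‖ ^ 2) := by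
    intro ξ
    have heq : ∀ r, ENNReal.ofReal (‖ξ‖ ^ 4 * (heat c ξ (r - s) ^ 2 * ‖V s ξ‖ ^ 2)) =
        ENNReal.ofReal (‖ξ‖ ^ 2 * ‖V s ξ‖ ^ 2) * ENNReal.ofReal (‖ξ‖ ^ 2 * heat c ξ (r - s) ^ 2) := by
      intro r
      rw [← ENNReal.ofReal_mul (by positivity)]
      congr 1; ring
    simp_rw [heq]
    rw [lintegral_const_mul' _ _ ENNReal.ofReal_ne_top, mul_comm]
    gcongr
    have hcont : Continuous fun r => ‖ξ‖ ^ 2 * heat c ξ (r - s) ^ 2 :=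
      continuous_const.mul ((continuous_heat_comp c continuous_const
        (continuous_id.sub continuous_const)).pow 2)
    calc ∫⁻ r in Ioc s t, ENNReal.ofReal (‖ξ‖ ^ 2 * heat c ξ (r - s) ^ 2)
        = ENNReal.ofReal (∫ r in s..t, ‖ξ‖ ^ 2 * heat c ξ (r - s) ^ 2) := by
          rw [intervalIntegral.integral_of_le hst, ofReal_integral_eq_lintegral_ofReal]
          · exact hcont.integrableOn_Icc.mono_set Ioc_subset_Icc_self
          · exact Eventually.of_forall fun r => by positivity
      _ ≤ ENNReal.ofReal ((2 * c)⁻¹) := by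
          refine ENNReal.ofReal_le_ofReal ?_
          have h3 : (2 * c) * ∫ r in s..t, ‖ξ‖ ^ 2 * heat c ξ (r - s) ^ 2 ≤ 1 := by
            have := two_mul_norm_sq_mul_integral_heat_sq_le' hc.le ξ s t
            rwa [intervalIntegral.integral_const_mul, ← mul_assoc]
          have := (le_div_iff₀' (by positivity : (0 : ℝ) < 2 * c)).2 h3
          rwa [one_div] at this
  -- measurability
  have hm_free : Measurable fun p : ℝ × EuclideanSpace ℝ ι =>
      ENNReal.ofReal (‖p.2‖ ^ 4 * (heat c p.2 (p.1 - s) ^ 2 * ‖V s p.2‖ ^ 2)) := by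
    refine ENNReal.measurable_ofReal.comp (Continuous.measurable ?_)
    exact ((continuous_norm.comp continuous_snd).pow 4).mul
      (((continuous_heat_comp c continuous_snd (continuous_fst.sub continuous_const)).pow 2).mul
        (((h.continuous_slice s).comp continuous_snd).norm.pow 2))
  have hm_duh : Measurable fun p : ℝ × EuclideanSpace ℝ ι =>
      ENNReal.ofReal (‖p.2‖ ^ 4 * ‖D p.1 p.2‖ ^ 2) :=
    ENNReal.measurable_ofReal.comp (((continuous_norm.comp continuous_snd).pow 4).mul
      (hDc.norm.pow 2)).measurable
  have hm_N : Measurable fun p : EuclideanSpace ℝ ι × ℝ =>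
      ENNReal.ofReal (‖nonlin (V p.2) (V p.2) p.1‖ ^ 2) :=
    ENNReal.measurable_ofReal.comp (((h.continuous_nonlin.comp continuous_swap).norm).pow 2).measurable
  -- the free double integral
  have hI₁ : ∫⁻ r in Ioc s t, ∫⁻ ξ, ENNReal.ofReal (‖ξ‖ ^ 4 * (heat c ξ (r - s) ^ 2 * ‖V s ξ‖ ^ 2)) ≤
      ENNReal.ofReal ((2 * c)⁻¹) * enst (V s) := by
    rw [lintegral_lintegral_swap hm_free.aemeasurable, enst,
      ← lintegral_const_mul' _ _ ENNReal.ofReal_ne_top]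
    exact lintegral_mono hfree
  -- the Duhamel double integral
  have hI₂ : ∫⁻ r in Ioc s t, ∫⁻ ξ, ENNReal.ofReal (‖ξ‖ ^ 4 * ‖D r ξ‖ ^ 2) ≤
      ENNReal.ofReal (c⁻¹ ^ 2) *
        (ENNReal.ofReal ((nonlinL2Const ι * M) ^ 2) * S * ENNReal.ofReal (t - s)) := by
    rw [lintegral_lintegral_swap hm_duh.aemeasurable]
    calc ∫⁻ ξ, ∫⁻ r in Ioc s t, ENNReal.ofReal (‖ξ‖ ^ 4 * ‖D r ξ‖ ^ 2)
        ≤ ∫⁻ ξ, ENNReal.ofReal (c⁻¹ ^ 2) *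
            ∫⁻ r' in Ioc s t, ENNReal.ofReal (‖nonlin (V r') (V r') ξ‖ ^ 2) :=
          lintegral_mono fun ξ => h.lintegral_Ioc_duhamel_le s t ξ
      _ = ENNReal.ofReal (c⁻¹ ^ 2) *
            ∫⁻ r' in Ioc s t, ∫⁻ ξ, ENNReal.ofReal (‖nonlin (V r') (V r') ξ‖ ^ 2) := by
          rw [lintegral_const_mul' _ _ ENNReal.ofReal_ne_top, lintegral_lintegral_swap hm_N.aemeasurable]
      _ = ENNReal.ofReal (c⁻¹ ^ 2) * ∫⁻ r' in Ioc s t, eLpNorm (nonlin (V r') (V r')) 2 volume ^ 2 := by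
          congr 1
          refine lintegral_congr fun r' => ?_
          rw [eLpNorm_two_sq]
          refine lintegral_congr fun ξ => ?_
          rw [← ofReal_norm, ENNReal.ofReal_pow (norm_nonneg _)]
      _ ≤ ENNReal.ofReal (c⁻¹ ^ 2) *
            (ENNReal.ofReal ((nonlinL2Const ι * M) ^ 2) * S * ENNReal.ofReal (t - s)) := by
          gcongr
          exact h.lintegral_Ioc_eLpNorm_nonlin_sq_le hM0 hM hs ht hS
  -- assemble
  have hm_in : ∀ r : ℝ, Measurable (fun ξ : EuclideanSpace ℝ ι =>
      2 * ENNReal.ofReal (‖ξ‖ ^ 4 * (heat c ξ (r - s) ^ 2 * ‖V s ξ‖ ^ 2))) := fun r => by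
    exact (hm_free.comp (Continuous.prodMk_right r).measurable).const_mul _
  have hm_out : Measurable (fun r : ℝ =>
      2 * ∫⁻ ξ, ENNReal.ofReal (‖ξ‖ ^ 4 * (heat c ξ (r - s) ^ 2 * ‖V s ξ‖ ^ 2))) := by
    exact (hm_free.lintegral_prod_right').const_mul _
  calc dissip V s t
      ≤ ∫⁻ r in Ioc s t, ∫⁻ ξ, (2 * ENNReal.ofReal (‖ξ‖ ^ 4 * (heat c ξ (r - s) ^ 2 * ‖V s ξ‖ ^ 2)) +
          2 * ENNReal.ofReal (‖ξ‖ ^ 4 * ‖D r ξ‖ ^ 2)) := by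
        refine setLIntegral_mono' measurableSet_Ioc fun r hr => lintegral_mono fun ξ => ?_
        refine (ENNReal.ofReal_le_ofReal (hpt r hr ξ)).trans_eq ?_
        rw [ENNReal.ofReal_add (by positivity) (by positivity), ENNReal.ofReal_mul zero_le_two,
          ENNReal.ofReal_mul zero_le_two, ENNReal.ofReal_ofNat]
    _ = ∫⁻ r in Ioc s t, ((2 * ∫⁻ ξ, ENNReal.ofReal (‖ξ‖ ^ 4 * (heat c ξ (r - s) ^ 2 * ‖V s ξ‖ ^ 2))) +
          2 * ∫⁻ ξ, ENNReal.ofReal (‖ξ‖ ^ 4 * ‖D r ξ‖ ^ 2)) := by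
        refine lintegral_congr fun r => ?_
        rw [lintegral_add_left (hm_in r), lintegral_const_mul' _ _ ENNReal.ofNat_ne_top,
          lintegral_const_mul' _ _ ENNReal.ofNat_ne_top]
    _ = (2 * ∫⁻ r in Ioc s t, ∫⁻ ξ, ENNReal.ofReal (‖ξ‖ ^ 4 * (heat c ξ (r - s) ^ 2 * ‖V s ξ‖ ^ 2))) +
          2 * ∫⁻ r in Ioc s t, ∫⁻ ξ, ENNReal.ofReal (‖ξ‖ ^ 4 * ‖D r ξ‖ ^ 2) := by
        rw [lintegral_add_left hm_out, lintegral_const_mul' _ _ ENNReal.ofNat_ne_top,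
          lintegral_const_mul' _ _ ENNReal.ofNat_ne_top]
    _ ≤ 2 * (ENNReal.ofReal ((2 * c)⁻¹) * enst (V s)) +
          2 * (ENNReal.ofReal (c⁻¹ ^ 2) *
            (ENNReal.ofReal ((nonlinL2Const ι * M) ^ 2) * S * ENNReal.ofReal (t - s))) :=
        add_le_add (by gcongr) (by gcongr)
    _ = ENNReal.ofReal c⁻¹ * enst (V s) +
          ENNReal.ofReal (2 * (nonlinL2Const ι * M) ^ 2 * (t - s) / c ^ 2) * S := by
        have e1 : 2 * ENNReal.ofReal ((2 * c)⁻¹) = ENNReal.ofReal c⁻¹ := by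
          rw [← ENNReal.ofReal_ofNat 2, ← ENNReal.ofReal_mul zero_le_two]
          congr 1; field_simp
        have e2 : ENNReal.ofReal (2 * (nonlinL2Const ι * M) ^ 2 * (t - s) / c ^ 2) =
            2 * ENNReal.ofReal (c⁻¹ ^ 2) * ENNReal.ofReal ((nonlinL2Const ι * M) ^ 2) *
              ENNReal.ofReal (t - s) := by
          rw [← ENNReal.ofReal_ofNat 2, ← ENNReal.ofReal_mul zero_le_two,
            ← ENNReal.ofReal_mul (by positivity), ← ENNReal.ofReal_mul (by positivity)]
          congr 1
          field_simp
        rw [← e1, e2]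
        ring

end Duhamel

/-! ### Pointwise control of the polynomial weights

The third a priori bound: the weighted sup-norms `sup_ξ (1+‖ξ‖)^K ‖V(t, ξ)‖` (the quantities
that control Picard's time in `NSFourierPicard`) at most double on every time window on which
`∫ (∫ ‖V(r, η)‖ dη)² dr` is small, uniformly — a smallness that the energy (`L²_ξ` bound of `V`)
and the dissipation bound supply (`sq_integral_norm_le`). -/

section Weights

variable [DecidableEq ι] {c t₀ t₁ : ℝ} {V : ℝ → EuclideanSpace ℝ ι → ι → ℂ}

omit [DecidableEq ι] in
/-- The weight on a decaying factor: `(1+‖η‖)^K ‖f η‖ ≤ A` for `HasDecay K A f`. [folklore] -/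
theorem weight_mul_norm_le {X : Type*} [NormedAddCommGroup X] {F : Type*} [NormedAddCommGroup F]
    {K : ℕ} {A : ℝ} {f : X → F} (hf : HasDecay K A f) (η : X) : (1 + ‖η‖) ^ K * ‖f η‖ ≤ A := by
  have hw : 0 < (1 + ‖η‖) ^ K := by positivity
  calc (1 + ‖η‖) ^ K * ‖f η‖ ≤ (1 + ‖η‖) ^ K * (A * ((1 + ‖η‖) ^ K)⁻¹) :=
        mul_le_mul_of_nonneg_left (hf η) hw.le
    _ = A := by field_simp

omit [DecidableEq ι] in
/-- Conversely, `(1+‖η‖)^K ‖f η‖ ≤ A` for all `η` is `HasDecay K A f`. [folklore] -/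
theorem hasDecay_of_weight_mul_norm_le {X : Type*} [NormedAddCommGroup X] {F : Type*}
    [NormedAddCommGroup F] {K : ℕ} {A : ℝ} {f : X → F} (hf : ∀ η, (1 + ‖η‖) ^ K * ‖f η‖ ≤ A) :
    HasDecay K A f := fun η => by
  have hw : 0 < (1 + ‖η‖) ^ K := by positivity
  rw [← div_eq_mul_inv, le_div_iff₀ hw, mul_comm]
  exact hf η

omit [DecidableEq ι] in
/-- **The weighted convolution bound with `L¹` norms**:
`(1+‖ξ‖)^K |(f ⋆ g)(ξ)| ≤ 2^K (A_f ‖g‖_{L¹} + A_g ‖f‖_{L¹})` for `f`, `g` with decay of order `K`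
(constants `A_f`, `A_g`) — Peetre's inequality puts the weight on one factor at a time
(Lemarié-Rieusset 2016, §8.5). [folklore] -/
theorem weight_mul_norm_fconv_le {K : ℕ} {f g : EuclideanSpace ℝ ι → ℂ} {Af Ag : ℝ}
    (hf : HasDecay K Af f) (hg : HasDecay K Ag g) (hfi : Integrable f) (hgi : Integrable g)
    (ξ : EuclideanSpace ℝ ι) :
    (1 + ‖ξ‖) ^ K * ‖fconv f g ξ‖ ≤ 2 ^ K * (Af * (∫ η, ‖g η‖) + Ag * ∫ η, ‖f η‖) := by
  have hAf := hf.nonneg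
  have hAg := hg.nonneg
  have hgb : ∀ η, ‖g η‖ ≤ Ag := fun η => hg.norm_le η
  have hfb : ∀ η, ‖f η‖ ≤ Af := fun η => hf.norm_le η
  -- the shifted factor
  have hgs : Integrable fun η => g (ξ - η) := hgi.comp_sub_left ξ
  have hgsn : Integrable fun η => ‖g (ξ - η)‖ := hgs.norm
  -- the basic bound `‖(f ⋆ g)(ξ)‖ ≤ ∫ ‖f η‖ ‖g (ξ - η)‖`
  have hprod : Integrable fun η => ‖f η‖ * ‖g (ξ - η)‖ :=
    hfi.norm.mul_bdd hgsn.aestronglyMeasurable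
      (Eventually.of_forall fun η => by rw [Real.norm_of_nonneg (norm_nonneg _)]; exact hgb _)
  have h0 : ‖fconv f g ξ‖ ≤ ∫ η, ‖f η‖ * ‖g (ξ - η)‖ := by
    rw [fconv_apply]
    refine (MeasureTheory.norm_integral_le_integral_norm _).trans_eq ?_
    exact integral_congr_ae (Eventually.of_forall fun η => norm_mul _ _)
  -- the two weighted integrands
  have hwc : Continuous fun η : EuclideanSpace ℝ ι => (1 + ‖ξ - η‖) ^ K :=
    (continuous_const.add (continuous_const.sub continuous_id).norm).pow K
  have hw2c : Continuous fun η : EuclideanSpace ℝ ι => (1 + ‖η‖) ^ K :=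
    (continuous_const.add continuous_norm).pow K
  have hi1 : Integrable fun η => ‖f η‖ * ((1 + ‖ξ - η‖) ^ K * ‖g (ξ - η)‖) :=
    hfi.norm.mul_bdd (hwc.aestronglyMeasurable.mul hgsn.aestronglyMeasurable)
      (Eventually.of_forall fun η => by
        rw [Real.norm_of_nonneg (by positivity)]; exact weight_mul_norm_le hg _)
  have hi2 : Integrable fun η => ((1 + ‖η‖) ^ K * ‖f η‖) * ‖g (ξ - η)‖ :=
    hgsn.bdd_mul (hw2c.aestronglyMeasurable.mul hfi.norm.aestronglyMeasurable)
      (Eventually.of_forall fun η => by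
        rw [Real.norm_of_nonneg (by positivity)]; exact weight_mul_norm_le hf _)
  -- pointwise Peetre
  have hpt : ∀ η, (1 + ‖ξ‖) ^ K * (‖f η‖ * ‖g (ξ - η)‖) ≤
      2 ^ K * (‖f η‖ * ((1 + ‖ξ - η‖) ^ K * ‖g (ξ - η)‖) + ((1 + ‖η‖) ^ K * ‖f η‖) * ‖g (ξ - η)‖) := by
    intro η
    have hP := one_add_norm_pow_le ξ η K
    have h0 : 0 ≤ ‖f η‖ * ‖g (ξ - η)‖ := by positivity
    calc (1 + ‖ξ‖) ^ K * (‖f η‖ * ‖g (ξ - η)‖)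
        ≤ (2 ^ K * ((1 + ‖ξ - η‖) ^ K + (1 + ‖η‖) ^ K)) * (‖f η‖ * ‖g (ξ - η)‖) :=
          mul_le_mul_of_nonneg_right hP h0
      _ = _ := by ring
  calc (1 + ‖ξ‖) ^ K * ‖fconv f g ξ‖ ≤ (1 + ‖ξ‖) ^ K * ∫ η, ‖f η‖ * ‖g (ξ - η)‖ :=
        mul_le_mul_of_nonneg_left h0 (by positivity)
    _ = ∫ η, (1 + ‖ξ‖) ^ K * (‖f η‖ * ‖g (ξ - η)‖) := (MeasureTheory.integral_const_mul _ _).symm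
    _ ≤ ∫ η, 2 ^ K * (‖f η‖ * ((1 + ‖ξ - η‖) ^ K * ‖g (ξ - η)‖) +
          ((1 + ‖η‖) ^ K * ‖f η‖) * ‖g (ξ - η)‖) :=
        integral_mono (hprod.const_mul _) ((hi1.add hi2).const_mul _) hpt
    _ = 2 ^ K * ((∫ η, ‖f η‖ * ((1 + ‖ξ - η‖) ^ K * ‖g (ξ - η)‖)) +
          ∫ η, ((1 + ‖η‖) ^ K * ‖f η‖) * ‖g (ξ - η)‖) := by
        rw [MeasureTheory.integral_const_mul, integral_add hi1 hi2]
    _ ≤ 2 ^ K * ((∫ η, ‖f η‖ * Ag) + ∫ η, Af * ‖g (ξ - η)‖) := by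
        have h1 : ∫ η, ‖f η‖ * ((1 + ‖ξ - η‖) ^ K * ‖g (ξ - η)‖) ≤ ∫ η, ‖f η‖ * Ag :=
          integral_mono hi1 (hfi.norm.mul_const _) fun η =>
            mul_le_mul_of_nonneg_left (weight_mul_norm_le hg _) (norm_nonneg _)
        have h2 : ∫ η, ((1 + ‖η‖) ^ K * ‖f η‖) * ‖g (ξ - η)‖ ≤ ∫ η, Af * ‖g (ξ - η)‖ :=
          integral_mono hi2 (hgsn.const_mul _) fun η =>
            mul_le_mul_of_nonneg_right (weight_mul_norm_le hf _) (norm_nonneg _)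
        exact mul_le_mul_of_nonneg_left (add_le_add h1 h2) (by positivity)
    _ = 2 ^ K * (Af * (∫ η, ‖g η‖) + Ag * ∫ η, ‖f η‖) := by
        rw [MeasureTheory.integral_mul_const, MeasureTheory.integral_const_mul,
          integral_sub_left_eq_self (fun η => ‖g η‖) volume ξ]
        ring

/-- The constant `C'_{ι,K} = 8π (card ι)² 2^K` of the weighted pointwise bound of the
nonlinearity. [folklore] -/
def decayWindowConst (ι : Type*) [Fintype ι] (K : ℕ) : ℝ :=
  8 * π * (Fintype.card ι : ℝ) ^ 2 * 2 ^ K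

omit [DecidableEq ι] in
/-- `0 ≤ C'_{ι,K}`. [folklore] -/
theorem decayWindowConst_nonneg (K : ℕ) : 0 ≤ decayWindowConst ι K := by
  unfold decayWindowConst; positivity

/-- **Weighted pointwise bound of the nonlinearity**: for `v` continuous with decay of the
integrable order `K₀` and of order `K` (constant `A`),
`(1+‖ξ‖)^K ‖N(v, v)(ξ)‖ ≤ C'_{ι,K} ‖ξ‖ A ‖v‖_{L¹}` — symbol bound `2‖ξ‖` and the weighted
convolution bound. [folklore] -/
theorem weight_mul_norm_nonlin_le (hK₀ : Fintype.card ι < K₀) {K : ℕ} {A A₀ : ℝ}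
    {v : EuclideanSpace ℝ ι → ι → ℂ} (hvc : Continuous v) (hv₀ : HasDecay K₀ A₀ v)
    (hv : HasDecay K A v) (ξ : EuclideanSpace ℝ ι) :
    (1 + ‖ξ‖) ^ K * ‖nonlin v v ξ‖ ≤ decayWindowConst ι K * ‖ξ‖ * A * ∫ η, ‖v η‖ := by
  have hA := hv.nonneg
  set g : ℝ := ∫ η, ‖v η‖ with hg
  have hvm : AEStronglyMeasurable v volume := hvc.aestronglyMeasurable
  have hvi : Integrable v := hv₀.integrable (finrank_lt_of_card_lt hK₀) hvm
  have hg0 : 0 ≤ g := integral_nonneg fun η => norm_nonneg _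
  have hvj_i : ∀ j, Integrable (fun η => v η j) := fun j =>
    (hv₀.apply j).integrable (finrank_lt_of_card_lt hK₀) (aesm_apply hvm j)
  have hgj : ∀ j, ∫ η, ‖v η j‖ ≤ g := fun j =>
    integral_mono (hvj_i j).norm hvi.norm fun η => norm_le_pi_norm (v η) j
  -- each convolution
  have hconv : ∀ j k, (1 + ‖ξ‖) ^ K * ‖fconv (v · j) (v · k) ξ‖ ≤ 2 ^ K * (2 * A * g) := by
    intro j k
    refine (weight_mul_norm_fconv_le (hv.apply j) (hv.apply k) (hvj_i j) (hvj_i k) ξ).trans ?_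
    refine mul_le_mul_of_nonneg_left ?_ (by positivity)
    calc A * (∫ η, ‖v η k‖) + A * (∫ η, ‖v η j‖) ≤ A * g + A * g :=
          add_le_add (mul_le_mul_of_nonneg_left (hgj k) hA) (mul_le_mul_of_nonneg_left (hgj j) hA)
      _ = 2 * A * g := by ring
  -- each component
  set B : ℝ := 2 * ‖ξ‖ * (2 ^ K * (2 * A * g)) with hB
  have hcomp : ∀ l, (1 + ‖ξ‖) ^ K * ‖nonlin v v ξ l‖ ≤ decayWindowConst ι K * ‖ξ‖ * A * g := by
    intro l
    rw [nonlin_apply, norm_mul]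
    have h2π : ‖-(2 * (π : ℂ) * Complex.I)‖ = 2 * π := by
      simp [Complex.norm_real, Real.norm_eq_abs, abs_of_pos Real.pi_pos]
    rw [h2π]
    have hterm : ∀ j k, (1 + ‖ξ‖) ^ K * ‖(lerayDerivSymbol j k l ξ : ℂ) * fconv (v · j) (v · k) ξ‖ ≤ B := by
      intro j k
      rw [norm_mul]
      calc (1 + ‖ξ‖) ^ K * (‖(lerayDerivSymbol j k l ξ : ℂ)‖ * ‖fconv (v · j) (v · k) ξ‖)
          ≤ (1 + ‖ξ‖) ^ K * ((2 * ‖ξ‖) * ‖fconv (v · j) (v · k) ξ‖) := by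
            gcongr; exact norm_ofReal_lerayDerivSymbol_le j k l ξ
        _ = 2 * ‖ξ‖ * ((1 + ‖ξ‖) ^ K * ‖fconv (v · j) (v · k) ξ‖) := by ring
        _ ≤ 2 * ‖ξ‖ * (2 ^ K * (2 * A * g)) := mul_le_mul_of_nonneg_left (hconv j k) (by positivity)
    calc (1 + ‖ξ‖) ^ K * (2 * π * ‖∑ j, ∑ k, (lerayDerivSymbol j k l ξ : ℂ) * fconv (v · j) (v · k) ξ‖)
        ≤ (1 + ‖ξ‖) ^ K * (2 * π * ∑ j, ∑ k, ‖(lerayDerivSymbol j k l ξ : ℂ) * fconv (v · j) (v · k) ξ‖) := by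
          gcongr
          exact (norm_sum_le _ _).trans (Finset.sum_le_sum fun j _ => norm_sum_le _ _)
      _ = 2 * π * ((1 + ‖ξ‖) ^ K *
            ∑ j, ∑ k, ‖(lerayDerivSymbol j k l ξ : ℂ) * fconv (v · j) (v · k) ξ‖) := by ring
      _ = 2 * π * ∑ j, ∑ k, (1 + ‖ξ‖) ^ K * ‖(lerayDerivSymbol j k l ξ : ℂ) * fconv (v · j) (v · k) ξ‖ := by
          congr 1
          rw [Finset.mul_sum]
          exact Finset.sum_congr rfl fun j _ => by rw [Finset.mul_sum]
      _ ≤ 2 * π * ∑ _j : ι, ∑ _k : ι, B := by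
          gcongr with j _ k _
          exact hterm j k
      _ = decayWindowConst ι K * ‖ξ‖ * A * g := by
          rw [Finset.sum_const, Finset.card_univ, Finset.sum_const, Finset.card_univ, nsmul_eq_mul,
            nsmul_eq_mul, hB, decayWindowConst]
          ring
  have hrhs : 0 ≤ decayWindowConst ι K * ‖ξ‖ * A * g := by
    have := decayWindowConst_nonneg (ι := ι) K; positivity
  have hw : 0 < (1 + ‖ξ‖) ^ K := by positivity
  rw [mul_comm, ← le_div_iff₀ hw]
  refine (pi_norm_le_iff_of_nonneg (by positivity)).2 fun l => ?_
  rw [le_div_iff₀ hw, mul_comm]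
  exact hcomp l

/-- The `L¹` mass `r ↦ ∫ ‖V(r, η)‖ dη` of a mild solution is continuous (dominated
convergence). [folklore] -/
theorem IsFourierMild.continuous_mass (h : IsFourierMild c K₀ t₀ t₁ V) :
    Continuous fun r => ∫ η, ‖V r η‖ := by
  obtain ⟨A, -, hA⟩ := h.decay₀
  exact continuous_of_dominated (F := fun r η => ‖V r η‖)
    (bound := fun η => A * ((1 + ‖η‖) ^ K₀)⁻¹)
    (fun r => (h.continuous_slice r).norm.aestronglyMeasurable)
    (fun r => Eventually.of_forall fun η => by
      rw [Real.norm_of_nonneg (norm_nonneg _)]; exact hA r η)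
    ((integrable_inv_one_add_norm_pow (E := EuclideanSpace ℝ ι)
      (finrank_lt_of_card_lt h.hK₀)).const_mul A)
    (Eventually.of_forall fun η => (h.continuous_time η).norm)

/-- **Doubling of the polynomial weights on a window with small `L²_t L¹_ξ` mass.** Let `V` be
mild on `[t₀, t₁]`, `t₀ ≤ s ≤ t ≤ t₁`, `HasDecay K Aₛ (V s)`, and suppose
`∫ₛᵗ (∫ ‖V(r, η)‖ dη)² dr ≤ G` with `C'² G ≤ c/2`. Then `HasDecay K (2Aₛ) (V r)` for every
`r ∈ [s, t]`: by the two-time Duhamel formula, the weighted bound of the nonlinearity and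
Cauchy–Schwarz in time, `(1+‖ξ‖)^K ‖V(r,ξ)‖ ≤ Aₛ + C' (G/2c)^{1/2} Ā` with `Ā` the (finite)
supremum of the weighted norms over the window, which is then absorbed (the propagation of the
weights in Lemarié-Rieusset 2016, §8.5, here with the energy-class smallness instead of a short
time). [folklore] -/
theorem IsFourierMild.hasDecay_of_window (h : IsFourierMild c K₀ t₀ t₁ V) {K : ℕ} {s t : ℝ}
    (hs : t₀ ≤ s) (hst : s ≤ t) (ht : t ≤ t₁) {Aₛ : ℝ} (hAs : HasDecay K Aₛ (V s)) {G : ℝ}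
    (hG : ∫ r in s..t, (∫ η, ‖V r η‖) ^ 2 ≤ G)
    (hsmall : decayWindowConst ι K ^ 2 * G ≤ c / 2) :
    ∀ r ∈ Icc s t, HasDecay K (2 * Aₛ) (V r) := by
  have hc := h.hc
  have hAs0 := hAs.nonneg
  have hC0 := decayWindowConst_nonneg (ι := ι) K
  obtain ⟨A₀, hA₀0, hA₀⟩ := h.decay₀
  obtain ⟨AK, hAK⟩ := h.decay K
  set g : ℝ → ℝ := fun r => ∫ η, ‖V r η‖ with hgdef
  have hgc : Continuous g := h.continuous_mass
  have hg0 : ∀ r, 0 ≤ g r := fun r => integral_nonneg fun η => norm_nonneg _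
  have hG0 : 0 ≤ G := le_trans (intervalIntegral.integral_nonneg hst fun r _ => sq_nonneg _) hG
  -- the finite supremum of the weighted norms over the window
  set Abar : ℝ≥0∞ := ⨆ r ∈ Icc s t, ⨆ ξ : EuclideanSpace ℝ ι,
    ENNReal.ofReal ((1 + ‖ξ‖) ^ K * ‖V r ξ‖) with hAbar
  have hAbar_le : Abar ≤ ENNReal.ofReal AK :=
    iSup₂_le fun r _ => iSup_le fun ξ => ENNReal.ofReal_le_ofReal (weight_mul_norm_le (hAK r) ξ)
  have hAbar_top : Abar ≠ ⊤ := ne_top_of_le_ne_top ENNReal.ofReal_ne_top hAbar_le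
  set a : ℝ := Abar.toReal with ha
  have ha0 : 0 ≤ a := ENNReal.toReal_nonneg
  have hle_Abar : ∀ r ∈ Icc s t, ∀ ξ, ENNReal.ofReal ((1 + ‖ξ‖) ^ K * ‖V r ξ‖) ≤ Abar := by
    intro r hr ξ
    refine le_trans ?_ (le_iSup₂ (f := fun r (_ : r ∈ Icc s t) => ⨆ ξ : EuclideanSpace ℝ ι,
      ENNReal.ofReal ((1 + ‖ξ‖) ^ K * ‖V r ξ‖)) r hr)
    exact le_iSup (fun ξ : EuclideanSpace ℝ ι => ENNReal.ofReal ((1 + ‖ξ‖) ^ K * ‖V r ξ‖)) ξ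
  have hdec : ∀ r ∈ Icc s t, HasDecay K a (V r) := fun r hr =>
    hasDecay_of_weight_mul_norm_le fun ξ =>
      (ENNReal.ofReal_le_iff_le_toReal hAbar_top).1 (hle_Abar r hr ξ)
  -- main estimate on the window
  have hmain : ∀ r ∈ Icc s t, ∀ ξ, (1 + ‖ξ‖) ^ K * ‖V r ξ‖ ≤ Aₛ + a / 2 := by
    intro r hr ξ
    set D : ι → ℂ := ∫ r' in s..r, heat c ξ (r - r') • nonlin (V r') (V r') ξ with hD
    have hVr : V r ξ = heat c ξ (r - s) • V s ξ - D := h.duhamel hs hr.1 (hr.2.trans ht) ξ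
    have hw0 : 0 < (1 + ‖ξ‖) ^ K := by positivity
    -- the free term
    have h1 : (1 + ‖ξ‖) ^ K * ‖V r ξ‖ ≤ Aₛ + (1 + ‖ξ‖) ^ K * ‖D‖ := by
      rw [hVr]
      calc (1 + ‖ξ‖) ^ K * ‖heat c ξ (r - s) • V s ξ - D‖
          ≤ (1 + ‖ξ‖) ^ K * (‖heat c ξ (r - s) • V s ξ‖ + ‖D‖) :=
            mul_le_mul_of_nonneg_left (norm_sub_le _ _) hw0.le
        _ = (1 + ‖ξ‖) ^ K * (heat c ξ (r - s) * ‖V s ξ‖) + (1 + ‖ξ‖) ^ K * ‖D‖ := by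
            rw [norm_heat_smul]; ring
        _ ≤ (1 + ‖ξ‖) ^ K * ‖V s ξ‖ + (1 + ‖ξ‖) ^ K * ‖D‖ := by
            gcongr
            exact mul_le_of_le_one_left (norm_nonneg _) (heat_le_one hc.le (by linarith [hr.1]) ξ)
        _ ≤ Aₛ + (1 + ‖ξ‖) ^ K * ‖D‖ := by
            gcongr
            exact weight_mul_norm_le hAs ξ
    -- the Duhamel term
    set k : ℝ → ℝ := fun r' => ‖ξ‖ * heat c ξ (r - r') with hk
    have hkc : Continuous k :=
      continuous_const.mul (continuous_heat_comp c continuous_const (continuous_const.sub continuous_id))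
    have hk0 : ∀ r', 0 ≤ k r' := fun r' => mul_nonneg (norm_nonneg _) (heat_nonneg _ _ _)
    set X : ℝ := ∫ r' in s..r, k r' * g r' with hX
    have hX0 : 0 ≤ X := intervalIntegral.integral_nonneg hr.1 fun r' _ => mul_nonneg (hk0 r') (hg0 r')
    have h2 : (1 + ‖ξ‖) ^ K * ‖D‖ ≤ decayWindowConst ι K * a * X := by
      have hD1 : ‖D‖ ≤ ∫ r' in s..r, heat c ξ (r - r') * ‖nonlin (V r') (V r') ξ‖ :=
        (intervalIntegral.norm_integral_le_integral_norm hr.1).trans_eq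
          (intervalIntegral.integral_congr fun r' _ => by simp only [norm_heat_smul])
      have hcont1 : Continuous fun r' => heat c ξ (r - r') * ((1 + ‖ξ‖) ^ K * ‖nonlin (V r') (V r') ξ‖) :=
        (continuous_heat_comp c continuous_const (continuous_const.sub continuous_id)).mul
          (continuous_const.mul (h.continuous_nonlin_time ξ).norm)
      have hcont2 : Continuous fun r' => heat c ξ (r - r') * (decayWindowConst ι K * ‖ξ‖ * a * g r') :=
        (continuous_heat_comp c continuous_const (continuous_const.sub continuous_id)).mul
          (continuous_const.mul hgc)
      calc (1 + ‖ξ‖) ^ K * ‖D‖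
          ≤ (1 + ‖ξ‖) ^ K * ∫ r' in s..r, heat c ξ (r - r') * ‖nonlin (V r') (V r') ξ‖ :=
            mul_le_mul_of_nonneg_left hD1 hw0.le
        _ = ∫ r' in s..r, heat c ξ (r - r') * ((1 + ‖ξ‖) ^ K * ‖nonlin (V r') (V r') ξ‖) := by
            rw [← intervalIntegral.integral_const_mul]
            exact intervalIntegral.integral_congr fun r' _ => by ring
        _ ≤ ∫ r' in s..r, heat c ξ (r - r') * (decayWindowConst ι K * ‖ξ‖ * a * g r') := by
            refine intervalIntegral.integral_mono_on hr.1 (hcont1.intervalIntegrable _ _)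
              (hcont2.intervalIntegrable _ _) fun r' hr' => ?_
            exact mul_le_mul_of_nonneg_left (weight_mul_norm_nonlin_le h.hK₀ (h.continuous_slice r')
              (hA₀ r') (hdec r' ⟨hr'.1, hr'.2.trans hr.2⟩) ξ) (heat_nonneg _ _ _)
        _ = decayWindowConst ι K * a * X := by
            rw [hX, ← intervalIntegral.integral_const_mul]
            exact intervalIntegral.integral_congr fun r' _ => by simp only [hk]; ring
    -- Cauchy–Schwarz in time
    have hX2 : X ^ 2 ≤ (2 * c)⁻¹ * G := by
      have hCS := sq_integral_mul_le hkc hgc hr.1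
      have hk2 : ∫ r' in s..r, k r' ^ 2 ≤ (2 * c)⁻¹ := by
        have h3 : 2 * c * ∫ r' in s..r, k r' ^ 2 ≤ 1 := by
          have := two_mul_norm_sq_mul_integral_heat_sq_le c ξ s r
          have e : ∫ r' in s..r, k r' ^ 2 = ‖ξ‖ ^ 2 * ∫ r' in s..r, heat c ξ (r - r') ^ 2 := by
            rw [← intervalIntegral.integral_const_mul]
            exact intervalIntegral.integral_congr fun r' _ => by simp only [hk]; ring
          rw [e, ← mul_assoc]; exact this
        have := (le_div_iff₀' (by positivity : (0 : ℝ) < 2 * c)).2 h3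
        rwa [one_div] at this
      have hg2 : ∫ r' in s..r, g r' ^ 2 ≤ G :=
        (intervalIntegral.integral_mono_interval le_rfl hr.1 hr.2
          (Eventually.of_forall fun r' => sq_nonneg _) ((hgc.pow 2).intervalIntegrable _ _)).trans hG
      have hg2' : 0 ≤ ∫ r' in s..r, g r' ^ 2 := intervalIntegral.integral_nonneg hr.1 fun r' _ => sq_nonneg _
      calc X ^ 2 ≤ (∫ r' in s..r, k r' ^ 2) * ∫ r' in s..r, g r' ^ 2 := hCS
        _ ≤ (2 * c)⁻¹ * G := mul_le_mul hk2 hg2 hg2' (by positivity)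
    -- `(C' X)² ≤ 1/4`, hence `C' X ≤ 1/2`
    have hCX : decayWindowConst ι K * X ≤ 1 / 2 := by
      have hsq : (decayWindowConst ι K * X) ^ 2 ≤ 1 / 4 := by
        calc (decayWindowConst ι K * X) ^ 2 = decayWindowConst ι K ^ 2 * X ^ 2 := by ring
          _ ≤ decayWindowConst ι K ^ 2 * ((2 * c)⁻¹ * G) :=
              mul_le_mul_of_nonneg_left hX2 (sq_nonneg _)
          _ = decayWindowConst ι K ^ 2 * G / (2 * c) := by ring
          _ ≤ (c / 2) / (2 * c) := div_le_div_of_nonneg_right hsmall (by positivity)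
          _ = 1 / 4 := by field_simp; ring
      nlinarith [mul_nonneg hC0 hX0]
    calc (1 + ‖ξ‖) ^ K * ‖V r ξ‖ ≤ Aₛ + (1 + ‖ξ‖) ^ K * ‖D‖ := h1
      _ ≤ Aₛ + decayWindowConst ι K * a * X := by linarith [h2]
      _ = Aₛ + a * (decayWindowConst ι K * X) := by ring
      _ ≤ Aₛ + a * (1 / 2) := by gcongr
      _ = Aₛ + a / 2 := by ring
  -- absorb the supremum
  have hAbar2 : Abar ≤ ENNReal.ofReal (Aₛ + a / 2) :=
    iSup₂_le fun r hr => iSup_le fun ξ => ENNReal.ofReal_le_ofReal (hmain r hr ξ)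
  have ha_le : a ≤ Aₛ + a / 2 := ENNReal.toReal_le_of_le_ofReal (by positivity) hAbar2
  have ha2 : a ≤ 2 * Aₛ := by linarith
  intro r hr
  exact (hdec r hr).mono ha2

/-- **Iterated doubling of the weights**: if on every window of length `≤ τ` inside `[t₀, t₁]`
the `L²_t L¹_ξ` mass is at most `G` with `C'² G ≤ c/2`, then
`HasDecay K (2ⁿ A₀) (V r)` for `r ∈ [t₀, t₁]`, `r ≤ t₀ + n τ`. [folklore] -/
theorem IsFourierMild.hasDecay_le_pow (h : IsFourierMild c K₀ t₀ t₁ V) {K : ℕ} {A₀ : ℝ}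
    (hA : HasDecay K A₀ (V t₀)) {τ G : ℝ} (hτ : 0 < τ)
    (hwin : ∀ s ∈ Icc t₀ t₁, ∀ t ∈ Icc s t₁, t - s ≤ τ → ∫ r in s..t, (∫ η, ‖V r η‖) ^ 2 ≤ G)
    (hsmall : decayWindowConst ι K ^ 2 * G ≤ c / 2) (n : ℕ) :
    ∀ r ∈ Icc t₀ t₁, r ≤ t₀ + n * τ → HasDecay K (2 ^ n * A₀) (V r) := by
  have hA0 := hA.nonneg
  induction n with
  | zero =>
    intro r hr hrn
    have : r = t₀ := le_antisymm (by simpa using hrn) hr.1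
    rw [this, pow_zero, one_mul]; exact hA
  | succ n ih =>
    intro r hr hrn
    by_cases hle : r ≤ t₀ + n * τ
    · refine (ih r hr hle).mono ?_
      gcongr
      · norm_num
      · exact Nat.le_succ n
    · push Not at hle
      set s := t₀ + n * τ with hsdef
      have hs0 : t₀ ≤ s := by
        have : (0 : ℝ) ≤ n * τ := by positivity
        linarith
      have hsI : s ∈ Icc t₀ t₁ := ⟨hs0, hle.le.trans hr.2⟩
      have hrs : r - s ≤ τ := by
        have : t₀ + (n + 1 : ℕ) * τ = s + τ := by rw [hsdef]; push_cast; ring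
        linarith [hrn]
      have hG := hwin s hsI r ⟨hle.le, hr.2⟩ hrs
      have h2 := h.hasDecay_of_window hs0 hle.le hr.2 (ih s hsI le_rfl) hG hsmall r ⟨hle.le, le_rfl⟩
      rw [pow_succ, mul_comm (2 ^ n) 2, mul_assoc]
      exact h2

/-- **Uniform weights on the whole interval**:
`HasDecay K (2^{⌈(t₁ - t₀)/τ⌉} A₀) (V r)` for all `r ∈ [t₀, t₁]` under the uniform window
hypothesis. [folklore] -/
theorem IsFourierMild.hasDecay_uniform (h : IsFourierMild c K₀ t₀ t₁ V) {K : ℕ} {A₀ : ℝ}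
    (hA : HasDecay K A₀ (V t₀)) {τ G : ℝ} (hτ : 0 < τ)
    (hwin : ∀ s ∈ Icc t₀ t₁, ∀ t ∈ Icc s t₁, t - s ≤ τ → ∫ r in s..t, (∫ η, ‖V r η‖) ^ 2 ≤ G)
    (hsmall : decayWindowConst ι K ^ 2 * G ≤ c / 2) :
    ∀ r ∈ Icc t₀ t₁, HasDecay K (2 ^ ⌈(t₁ - t₀) / τ⌉₊ * A₀) (V r) := by
  intro r hr
  refine h.hasDecay_le_pow hA hτ hwin hsmall _ r hr ?_
  have h1 : (t₁ - t₀) / τ ≤ ⌈(t₁ - t₀) / τ⌉₊ := Nat.le_ceil _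
  rw [div_le_iff₀ hτ] at h1
  linarith [hr.2]

/-! ### The `L²_t L¹_ξ` mass from energy and dissipation -/

omit [DecidableEq ι] [Fintype ι] in
/-- **Cauchy–Schwarz for integrals**, squared form, for integrable real functions on any measure
space: `(∫ f g)² ≤ (∫ f²)(∫ g²)`. [folklore] -/
theorem sq_integral_mul_le_of_integrable {α : Type*} [MeasurableSpace α] {μ : Measure α}
    {f g : α → ℝ} (hf2 : Integrable (fun x => f x ^ 2) μ) (hg2 : Integrable (fun x => g x ^ 2) μ)
    (hfg : Integrable (fun x => f x * g x) μ) :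
    (∫ x, f x * g x ∂μ) ^ 2 ≤ (∫ x, f x ^ 2 ∂μ) * ∫ x, g x ^ 2 ∂μ := by
  have hq : ∀ y : ℝ, 0 ≤ (∫ x, f x ^ 2 ∂μ) * (y * y) + (-2 * ∫ x, f x * g x ∂μ) * y +
      ∫ x, g x ^ 2 ∂μ := by
    intro y
    have h0 : 0 ≤ ∫ x, (y * f x - g x) ^ 2 ∂μ := integral_nonneg fun x => sq_nonneg _
    have hexp : ∫ x, (y * f x - g x) ^ 2 ∂μ =
        (∫ x, f x ^ 2 ∂μ) * (y * y) + (-2 * ∫ x, f x * g x ∂μ) * y + ∫ x, g x ^ 2 ∂μ := by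
      have e1 : (fun x => (y * f x - g x) ^ 2) =
          fun x => (y * y) * f x ^ 2 + (-2 * y) * (f x * g x) + g x ^ 2 := by
        funext x; ring
      rw [e1, integral_add _ hg2, integral_add (hf2.const_mul _) (hfg.const_mul _),
        MeasureTheory.integral_const_mul, MeasureTheory.integral_const_mul]
      · ring
      · exact (hf2.const_mul _).add (hfg.const_mul _)
    rw [← hexp]; exact h0
  have hd := discrim_le_zero hq
  rw [discrim] at hd
  nlinarith [hd]

omit [DecidableEq ι] in
/-- The tail mass `∫_{‖η‖ > ρ} 16 (1+‖η‖)^{-4} dη` of the comparison weight (finite when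
`card ι < 4`; it dominates `∫_{‖η‖ > ρ} ‖η‖^{-4}` for `ρ ≥ 1`). [folklore] -/
def tailMass (ι : Type*) [Fintype ι] (ρ : ℝ) : ℝ :=
  ∫ η in (Metric.closedBall (0 : EuclideanSpace ℝ ι) ρ)ᶜ, 16 * ((1 + ‖η‖) ^ 4)⁻¹

omit [DecidableEq ι] in
/-- `0 ≤ tailMass ι ρ`. [folklore] -/
theorem tailMass_nonneg (ρ : ℝ) : 0 ≤ tailMass ι ρ :=
  setIntegral_nonneg (measurableSet_closedBall.compl) fun η _ => by positivity

omit [DecidableEq ι] in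
/-- For `‖η‖ ≥ 1`: `‖η‖^{-4} ≤ 16 (1 + ‖η‖)^{-4}` (`1 + ‖η‖ ≤ 2‖η‖`). [folklore] -/
theorem inv_norm_pow_four_le {η : EuclideanSpace ℝ ι} (hη : 1 ≤ ‖η‖) :
    ((‖η‖ ^ 2)⁻¹) ^ 2 ≤ 16 * ((1 + ‖η‖) ^ 4)⁻¹ := by
  have hη0 : 0 < ‖η‖ := by linarith
  have h1 : (1 + ‖η‖) ^ 4 ≤ 16 * ‖η‖ ^ 4 := by
    calc (1 + ‖η‖) ^ 4 ≤ (2 * ‖η‖) ^ 4 := pow_le_pow_left₀ (by positivity) (by linarith) 4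
      _ = 16 * ‖η‖ ^ 4 := by ring
  have h4 : 0 < (1 + ‖η‖) ^ 4 := by positivity
  rw [← one_div, ← one_div, div_pow, one_pow, ← pow_mul, show 2 * 2 = 4 by norm_num,
    div_le_iff₀ (by positivity : (0 : ℝ) < ‖η‖ ^ 4)]
  calc (1 : ℝ) = 16 * (1 / (1 + ‖η‖) ^ 4) * ((1 + ‖η‖) ^ 4 / 16) := by field_simp
    _ ≤ 16 * (1 / (1 + ‖η‖) ^ 4) * ‖η‖ ^ 4 := by
        gcongr
        rw [div_le_iff₀ (by norm_num : (0 : ℝ) < 16)]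
        linarith

omit [DecidableEq ι] in
/-- **Splitting the `L¹` norm at a frequency radius.** For `ρ ≥ 1`, `card ι < 4` and a
continuous integrable `f` with `‖f‖², ‖η‖⁴‖f‖²` integrable,
`(∫ ‖f‖)² ≤ 2 |B_ρ| ∫ ‖f‖² + 2 tailMass(ρ) ∫ ‖η‖⁴ ‖f‖²` (Cauchy–Schwarz on `B_ρ` with the
constant `1`, and on its complement with the weight `‖η‖^{-2}`). [folklore] -/
theorem sq_integral_norm_le_split (hι : Fintype.card ι < 4) {F : Type*} [NormedAddCommGroup F]
    {f : EuclideanSpace ℝ ι → F} (hfm : AEStronglyMeasurable f volume) (hfi : Integrable f)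
    (h2 : Integrable fun η => ‖f η‖ ^ 2) (h4 : Integrable fun η => ‖η‖ ^ 4 * ‖f η‖ ^ 2) {ρ : ℝ}
    (hρ : 1 ≤ ρ) :
    (∫ η, ‖f η‖) ^ 2 ≤
      2 * (volume (Metric.closedBall (0 : EuclideanSpace ℝ ι) ρ)).toReal * (∫ η, ‖f η‖ ^ 2) +
        2 * tailMass ι ρ * ∫ η, ‖η‖ ^ 4 * ‖f η‖ ^ 2 := by
  set B := Metric.closedBall (0 : EuclideanSpace ℝ ι) ρ with hB
  have hBm : MeasurableSet B := measurableSet_closedBall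
  have hBfin : volume B < ⊤ := measure_closedBall_lt_top
  have hsplit : ∫ η, ‖f η‖ = (∫ η in B, ‖f η‖) + ∫ η in Bᶜ, ‖f η‖ :=
    (integral_add_compl hBm hfi.norm).symm
  -- the ball
  have hball : (∫ η in B, ‖f η‖) ^ 2 ≤ (volume B).toReal * ∫ η, ‖f η‖ ^ 2 := by
    have h1 : IntegrableOn (fun _ : EuclideanSpace ℝ ι => (1 : ℝ) ^ 2) B volume :=
      integrableOn_const hBfin.ne
    have h3 : IntegrableOn (fun η => (1 : ℝ) * ‖f η‖) B volume :=
      (hfi.norm.integrableOn (s := B)).congr_fun (fun η _ => (one_mul _).symm) hBm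
    have hcs := sq_integral_mul_le_of_integrable (μ := volume.restrict B)
      (f := fun _ => (1 : ℝ)) (g := fun η => ‖f η‖) h1 h2.integrableOn h3
    simp only [one_mul, one_pow] at hcs
    calc (∫ η in B, ‖f η‖) ^ 2 ≤ (∫ _ in B, (1 : ℝ)) * ∫ η in B, ‖f η‖ ^ 2 := hcs
      _ ≤ (volume B).toReal * ∫ η, ‖f η‖ ^ 2 := by
          rw [setIntegral_const, smul_eq_mul, mul_one, measureReal_def]
          exact mul_le_mul_of_nonneg_left
            (setIntegral_le_integral h2 (Eventually.of_forall fun η => sq_nonneg _))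
            ENNReal.toReal_nonneg
  -- the complement
  have hcompl : (∫ η in Bᶜ, ‖f η‖) ^ 2 ≤ tailMass ι ρ * ∫ η, ‖η‖ ^ 4 * ‖f η‖ ^ 2 := by
    have hmem : ∀ η ∈ Bᶜ, 1 ≤ ‖η‖ := fun η hη => by
      have : ρ < ‖η‖ := by simpa [hB, Metric.mem_closedBall, dist_zero_right] using hη
      linarith
    -- rewrite the integrand with the weight `‖η‖^{-2}`
    have heq : ∫ η in Bᶜ, ‖f η‖ = ∫ η in Bᶜ, (‖η‖ ^ 2)⁻¹ * (‖η‖ ^ 2 * ‖f η‖) := by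
      refine setIntegral_congr_fun hBm.compl fun η hη => ?_
      have : ‖η‖ ≠ 0 := by linarith [hmem η hη]
      field_simp
    have hw := ((integrable_inv_one_add_norm_pow (E := EuclideanSpace ℝ ι) (K := 4)
      (by simpa using hι)).const_mul 16).integrableOn (s := Bᶜ)
    have hmeas_inv : Measurable fun η : EuclideanSpace ℝ ι => (‖η‖ ^ 2)⁻¹ :=
      (continuous_norm.pow 2).measurable.inv
    have hwint : IntegrableOn (fun η : EuclideanSpace ℝ ι => ((‖η‖ ^ 2)⁻¹) ^ 2) Bᶜ volume := by
      refine hw.mono' (hmeas_inv.pow_const 2).aestronglyMeasurable ?_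
      exact (ae_restrict_iff' hBm.compl).2 (Eventually.of_forall fun η hη => by
        rw [Real.norm_of_nonneg (by positivity)]; exact inv_norm_pow_four_le (hmem η hη))
    have hgint : IntegrableOn (fun η : EuclideanSpace ℝ ι => (‖η‖ ^ 2 * ‖f η‖) ^ 2) Bᶜ volume :=
      (h4.congr (Eventually.of_forall fun η => by simp only; ring)).integrableOn
    have hprodint : IntegrableOn (fun η : EuclideanSpace ℝ ι => (‖η‖ ^ 2)⁻¹ * (‖η‖ ^ 2 * ‖f η‖))
        Bᶜ volume := by
      refine (hfi.norm.integrableOn (s := Bᶜ)).integrable.mono' ?_ ?_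
      · exact (hmeas_inv.aestronglyMeasurable.mul
          (((continuous_norm.pow 2).aestronglyMeasurable).mul hfm.norm)).restrict
      · refine Eventually.of_forall fun η => ?_
        rw [Real.norm_of_nonneg (by positivity), ← mul_assoc]
        refine mul_le_of_le_one_left (norm_nonneg _) ?_
        by_cases h0 : ‖η‖ ^ 2 = 0
        · rw [h0]; simp
        · rw [inv_mul_cancel₀ h0]
    have hcs := sq_integral_mul_le_of_integrable (μ := volume.restrict Bᶜ) hwint hgint hprodint
    have hw2 : ∫ η in Bᶜ, ((‖η‖ ^ 2)⁻¹) ^ 2 ≤ tailMass ι ρ :=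
      setIntegral_mono_on hwint hw hBm.compl fun η hη => inv_norm_pow_four_le (hmem η hη)
    have hg2 : ∫ η in Bᶜ, (‖η‖ ^ 2 * ‖f η‖) ^ 2 ≤ ∫ η, ‖η‖ ^ 4 * ‖f η‖ ^ 2 := by
      calc ∫ η in Bᶜ, (‖η‖ ^ 2 * ‖f η‖) ^ 2 = ∫ η in Bᶜ, ‖η‖ ^ 4 * ‖f η‖ ^ 2 :=
            integral_congr_ae (Eventually.of_forall fun η => by simp only; ring)
        _ ≤ ∫ η, ‖η‖ ^ 4 * ‖f η‖ ^ 2 :=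
            setIntegral_le_integral h4 (Eventually.of_forall fun η => by positivity)
    have hg2' : 0 ≤ ∫ η in Bᶜ, (‖η‖ ^ 2 * ‖f η‖) ^ 2 := integral_nonneg fun η => sq_nonneg _
    calc (∫ η in Bᶜ, ‖f η‖) ^ 2 = (∫ η in Bᶜ, (‖η‖ ^ 2)⁻¹ * (‖η‖ ^ 2 * ‖f η‖)) ^ 2 := by rw [heq]
      _ ≤ (∫ η in Bᶜ, ((‖η‖ ^ 2)⁻¹) ^ 2) * ∫ η in Bᶜ, (‖η‖ ^ 2 * ‖f η‖) ^ 2 := hcs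
      _ ≤ tailMass ι ρ * ∫ η, ‖η‖ ^ 4 * ‖f η‖ ^ 2 := mul_le_mul hw2 hg2 hg2' (tailMass_nonneg ρ)
  -- combine
  have hvB : 0 ≤ (volume B).toReal * ∫ η, ‖f η‖ ^ 2 :=
    mul_nonneg ENNReal.toReal_nonneg (integral_nonneg fun η => sq_nonneg _)
  rw [hsplit]
  nlinarith [hball, hcompl, sq_nonneg ((∫ η in B, ‖f η‖) - ∫ η in Bᶜ, ‖f η‖)]

omit [DecidableEq ι] in
/-- `‖f‖²` is integrable for a bounded integrable `f` (`‖f‖² ≤ A ‖f‖`). [folklore] -/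
theorem integrable_norm_sq_of_hasDecay (hK₀ : Fintype.card ι < K₀) {F : Type*} [NormedAddCommGroup F]
    {f : EuclideanSpace ℝ ι → F} {A : ℝ} (hf : HasDecay K₀ A f) (hfm : AEStronglyMeasurable f volume) :
    Integrable fun η => ‖f η‖ ^ 2 := by
  have hi := (hf.integrable (finrank_lt_of_card_lt hK₀) hfm).norm.const_mul A
  refine hi.mono' (hfm.norm.pow 2) (Eventually.of_forall fun η => ?_)
  rw [Real.norm_of_nonneg (sq_nonneg _), sq]
  exact mul_le_mul_of_nonneg_right (hf.norm_le η) (norm_nonneg _)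

omit [DecidableEq ι] in
/-- `‖η‖⁴ ‖f‖²` is integrable for `f` with decay of order `2 + K₀`
(`‖η‖⁴‖f‖² ≤ A · ‖η‖²‖f‖`). [folklore] -/
theorem integrable_norm_pow_four_mul_norm_sq_of_hasDecay (hK₀ : Fintype.card ι < K₀) {F : Type*}
    [NormedAddCommGroup F] {f : EuclideanSpace ℝ ι → F} {A : ℝ} (hf : HasDecay (2 + K₀) A f)
    (hfm : AEStronglyMeasurable f volume) :
    Integrable fun η => ‖η‖ ^ 4 * ‖f η‖ ^ 2 := by
  have hA := hf.nonneg
  have hi := (hf.integrable_pow_mul_norm (n := 2) (finrank_lt_of_card_lt hK₀) hfm).const_mul A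
  have hb : ∀ η : EuclideanSpace ℝ ι, ‖η‖ ^ 2 * ‖f η‖ ≤ A := fun η => by
    calc ‖η‖ ^ 2 * ‖f η‖ ≤ (1 + ‖η‖) ^ (2 + K₀) * ‖f η‖ := by
          refine mul_le_mul_of_nonneg_right ?_ (norm_nonneg _)
          calc ‖η‖ ^ 2 ≤ (1 + ‖η‖) ^ 2 := pow_le_pow_left₀ (norm_nonneg _) (by linarith [norm_nonneg η]) 2
            _ ≤ (1 + ‖η‖) ^ (2 + K₀) :=
                pow_le_pow_right₀ (by linarith [norm_nonneg η]) (Nat.le_add_right 2 K₀)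
      _ ≤ A := weight_mul_norm_le hf η
  refine hi.mono' ((continuous_norm.pow 4).aestronglyMeasurable.mul (hfm.norm.pow 2))
    (Eventually.of_forall fun η => ?_)
  rw [Real.norm_of_nonneg (by positivity)]
  calc ‖η‖ ^ 4 * ‖f η‖ ^ 2 = (‖η‖ ^ 2 * ‖f η‖) * (‖η‖ ^ 2 * ‖f η‖) := by ring
    _ ≤ A * (‖η‖ ^ 2 * ‖f η‖) := mul_le_mul_of_nonneg_right (hb η) (by positivity)

/-- **The `L²_t L¹_ξ` mass of a window from energy and dissipation.** For `V` mild on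
`[t₀, t₁]` in dimension `card ι < 4`, `t₀ ≤ s ≤ t ≤ t₁`, with `∫ ‖V(r)‖² ≤ Λ` on `[t₀, t₁]`,
`𝒟(V; s, t) ≤ D` and `ρ ≥ 1`:
`∫ₛᵗ (∫ ‖V(r, η)‖ dη)² dr ≤ 2 |B_ρ| Λ (t - s) + 2 tailMass(ρ) D`. [folklore] -/
theorem IsFourierMild.mass_sq_integral_le (h : IsFourierMild c K₀ t₀ t₁ V) (hι : Fintype.card ι < 4)
    {Λ : ℝ} (hΛ0 : 0 ≤ Λ) (hE : ∀ r ∈ Icc t₀ t₁, ∫⁻ η, ‖V r η‖ₑ ^ 2 ≤ ENNReal.ofReal Λ)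
    {s t : ℝ} (hs : t₀ ≤ s) (hst : s ≤ t) (ht : t ≤ t₁) {ρ : ℝ} (hρ : 1 ≤ ρ) {Dd : ℝ}
    (hD0 : 0 ≤ Dd) (hD : dissip V s t ≤ ENNReal.ofReal Dd) :
    ∫ r in s..t, (∫ η, ‖V r η‖) ^ 2 ≤
      2 * (volume (Metric.closedBall (0 : EuclideanSpace ℝ ι) ρ)).toReal * Λ * (t - s) +
        2 * tailMass ι ρ * Dd := by
  obtain ⟨A₀, hA₀0, hA₀⟩ := h.decay₀
  obtain ⟨A₂, hA₂⟩ := h.decay (2 + K₀)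
  have hA₂0 : 0 ≤ A₂ := (hA₂ s).nonneg
  set vB : ℝ := (volume (Metric.closedBall (0 : EuclideanSpace ℝ ι) ρ)).toReal with hvB
  have hvB0 : 0 ≤ vB := ENNReal.toReal_nonneg
  have htm0 := tailMass_nonneg (ι := ι) ρ
  -- the two slice functionals
  set F : ℝ → ℝ := fun r => ∫ η, ‖V r η‖ ^ 2 with hF
  set H : ℝ → ℝ := fun r => ∫ η, ‖η‖ ^ 4 * ‖V r η‖ ^ 2 with hH
  have hFi : ∀ r, Integrable fun η => ‖V r η‖ ^ 2 := fun r =>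
    integrable_norm_sq_of_hasDecay h.hK₀ (hA₀ r) (h.aestronglyMeasurable_slice r)
  have hHi : ∀ r, Integrable fun η : EuclideanSpace ℝ ι => ‖η‖ ^ 4 * ‖V r η‖ ^ 2 := fun r =>
    integrable_norm_pow_four_mul_norm_sq_of_hasDecay h.hK₀ (hA₂ r) (h.aestronglyMeasurable_slice r)
  -- continuity in time (dominated convergence)
  have hbound_int := (integrable_inv_one_add_norm_pow (E := EuclideanSpace ℝ ι)
    (finrank_lt_of_card_lt h.hK₀))
  have hFc : Continuous F := by
    refine continuous_of_dominated (F := fun r η => ‖V r η‖ ^ 2)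
      (bound := fun η => A₀ * (A₀ * ((1 + ‖η‖) ^ K₀)⁻¹))
      (fun r => ((h.continuous_slice r).norm.pow 2).aestronglyMeasurable)
      (fun r => Eventually.of_forall fun η => ?_) (hbound_int.const_mul _ |>.const_mul _)
      (Eventually.of_forall fun η => ((h.continuous_time η).norm).pow 2)
    rw [Real.norm_of_nonneg (sq_nonneg _), sq]
    exact mul_le_mul ((hA₀ r).norm_le η) (hA₀ r η) (norm_nonneg _) hA₀0
  have hHc : Continuous H := by
    refine continuous_of_dominated (F := fun r η => ‖η‖ ^ 4 * ‖V r η‖ ^ 2)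
      (bound := fun η => A₂ * (A₂ * ((1 + ‖η‖) ^ K₀)⁻¹))
      (fun r => ((continuous_norm.pow 4).mul ((h.continuous_slice r).norm.pow 2)).aestronglyMeasurable)
      (fun r => Eventually.of_forall fun η => ?_) (hbound_int.const_mul _ |>.const_mul _)
      (Eventually.of_forall fun η => continuous_const.mul (((h.continuous_time η).norm).pow 2))
    rw [Real.norm_of_nonneg (by positivity)]
    have hb : ‖η‖ ^ 2 * ‖V r η‖ ≤ A₂ * ((1 + ‖η‖) ^ K₀)⁻¹ := by
      have hw : 0 < (1 + ‖η‖) ^ K₀ := by positivity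
      calc ‖η‖ ^ 2 * ‖V r η‖ ≤ (1 + ‖η‖) ^ 2 * (A₂ * ((1 + ‖η‖) ^ (2 + K₀))⁻¹) :=
            mul_le_mul (pow_le_pow_left₀ (norm_nonneg _) (by linarith [norm_nonneg η]) 2)
              (hA₂ r η) (norm_nonneg _) (by positivity)
        _ = A₂ * ((1 + ‖η‖) ^ K₀)⁻¹ := by rw [pow_add]; field_simp
    have hb' : ‖η‖ ^ 2 * ‖V r η‖ ≤ A₂ := hb.trans (mul_le_of_le_one_right hA₂0 (inv_one_add_norm_pow_le_one η K₀))
    calc ‖η‖ ^ 4 * ‖V r η‖ ^ 2 = (‖η‖ ^ 2 * ‖V r η‖) * (‖η‖ ^ 2 * ‖V r η‖) := by ring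
      _ ≤ A₂ * (A₂ * ((1 + ‖η‖) ^ K₀)⁻¹) := mul_le_mul hb' hb (by positivity) hA₂0
  -- pointwise in time
  have hpt : ∀ r ∈ Icc s t, (∫ η, ‖V r η‖) ^ 2 ≤ 2 * vB * F r + 2 * tailMass ι ρ * H r := fun r _ =>
    sq_integral_norm_le_split hι (h.aestronglyMeasurable_slice r) (h.integrable_slice r) (hFi r)
      (hHi r) hρ
  -- `F ≤ Λ` on the window
  have hFle : ∀ r ∈ Icc s t, F r ≤ Λ := by
    intro r hr
    have hrI : r ∈ Icc t₀ t₁ := ⟨hs.trans hr.1, hr.2.trans ht⟩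
    have h1 : F r = (∫⁻ η, ‖V r η‖ₑ ^ 2).toReal := by
      show (∫ η, ‖V r η‖ ^ 2) = _
      rw [integral_eq_lintegral_of_nonneg_ae (Eventually.of_forall fun η => sq_nonneg _)
        ((h.continuous_slice r).norm.pow 2).aestronglyMeasurable]
      congr 1
      refine lintegral_congr fun η => ?_
      rw [← ofReal_norm, ENNReal.ofReal_pow (norm_nonneg _)]
    rw [h1]
    exact ENNReal.toReal_le_of_le_ofReal hΛ0 (hE r hrI)
  -- `∫ H = 𝒟 ≤ D`
  have hHint : ∫ r in s..t, H r ≤ Dd := by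
    have hH0 : ∀ r, 0 ≤ H r := fun r => integral_nonneg fun η => by positivity
    have hdiss : dissip V s t = ENNReal.ofReal (∫ r in s..t, H r) := by
      rw [dissip, intervalIntegral.integral_of_le hst,
        ofReal_integral_eq_lintegral_ofReal (hHc.integrableOn_Icc.mono_set Ioc_subset_Icc_self)
          (Eventually.of_forall hH0)]
      refine lintegral_congr fun r => ?_
      rw [hH, ofReal_integral_eq_lintegral_ofReal (hHi r) (Eventually.of_forall fun η => by positivity)]
    have h0 : 0 ≤ ∫ r in s..t, H r := intervalIntegral.integral_nonneg hst fun r _ => hH0 r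
    have := hD
    rw [hdiss] at this
    exact (ENNReal.ofReal_le_ofReal_iff hD0).1 this
  -- integrate
  have hgc : Continuous fun r => (∫ η, ‖V r η‖) ^ 2 := h.continuous_mass.pow 2
  have hI1 : IntervalIntegrable (fun r => 2 * vB * F r) volume s t :=
    (continuous_const.mul hFc).intervalIntegrable _ _
  have hI2 : IntervalIntegrable (fun r => 2 * tailMass ι ρ * H r) volume s t :=
    (continuous_const.mul hHc).intervalIntegrable _ _
  calc ∫ r in s..t, (∫ η, ‖V r η‖) ^ 2
      ≤ ∫ r in s..t, (2 * vB * F r + 2 * tailMass ι ρ * H r) :=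
        intervalIntegral.integral_mono_on hst (hgc.intervalIntegrable _ _) (hI1.add hI2) hpt
    _ = 2 * vB * (∫ r in s..t, F r) + 2 * tailMass ι ρ * ∫ r in s..t, H r := by
        rw [intervalIntegral.integral_add hI1 hI2, intervalIntegral.integral_const_mul,
          intervalIntegral.integral_const_mul]
    _ ≤ 2 * vB * (Λ * (t - s)) + 2 * tailMass ι ρ * Dd := by
        gcongr
        calc ∫ r in s..t, F r ≤ ∫ _ in s..t, Λ :=
              intervalIntegral.integral_mono_on hst (hFc.intervalIntegrable _ _)
                (continuous_const.intervalIntegrable _ _) hFle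
          _ = Λ * (t - s) := by rw [intervalIntegral.integral_const, smul_eq_mul]; ring
    _ = 2 * vB * Λ * (t - s) + 2 * tailMass ι ρ * Dd := by ring

omit [DecidableEq ι] in
/-- **The tail mass is small for large radius** (`card ι < 4`): for every `ε > 0` there is
`ρ ≥ 1` with `tailMass ι ρ ≤ ε` (dominated convergence for the tails of an integrable
function). [folklore] -/
theorem exists_tailMass_le (hι : Fintype.card ι < 4) {ε : ℝ} (hε : 0 < ε) :
    ∃ ρ : ℝ, 1 ≤ ρ ∧ tailMass ι ρ ≤ ε := by
  set w : EuclideanSpace ℝ ι → ℝ := fun η => 16 * ((1 + ‖η‖) ^ 4)⁻¹ with hw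
  have hwi : Integrable w := (integrable_inv_one_add_norm_pow (E := EuclideanSpace ℝ ι) (K := 4)
    (by simpa using hι)).const_mul 16
  set f : ℕ → EuclideanSpace ℝ ι → ℝ := fun n => (Metric.closedBall (0 : EuclideanSpace ℝ ι) n)ᶜ.indicator w
    with hf
  have htail : ∀ n : ℕ, tailMass ι n = ∫ η, f n η := fun n => by
    simp only [hf, tailMass, hw]
    rw [MeasureTheory.integral_indicator measurableSet_closedBall.compl]
  have hlim : Tendsto (fun n => ∫ η, f n η) atTop (𝓝 (∫ _ : EuclideanSpace ℝ ι, (0 : ℝ))) := by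
    refine tendsto_integral_of_dominated_convergence w
      (fun n => (hwi.indicator measurableSet_closedBall.compl).aestronglyMeasurable) hwi
      (fun n => Eventually.of_forall fun η => ?_) (Eventually.of_forall fun η => ?_)
    · rw [hf]
      refine (norm_indicator_le_norm_self _ _).trans ?_
      rw [Real.norm_of_nonneg (by positivity)]
    · -- eventually `η ∈ B_n`, so the indicator vanishes
      refine tendsto_const_nhds.congr' ?_
      obtain ⟨N, hN⟩ := exists_nat_gt ‖η‖
      refine (eventually_ge_atTop N).mono fun n hn => ?_
      have hmem : η ∈ Metric.closedBall (0 : EuclideanSpace ℝ ι) n := by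
        rw [Metric.mem_closedBall, dist_zero_right]
        exact (hN.trans_le (by exact_mod_cast hn)).le
      rw [hf]
      exact (Set.indicator_of_notMem (Set.notMem_compl_iff.2 hmem) _).symm
  rw [MeasureTheory.integral_zero] at hlim
  obtain ⟨N, hN⟩ := (Metric.tendsto_atTop.1 hlim) ε hε
  refine ⟨max N 1, by exact_mod_cast le_max_right N 1, ?_⟩
  have h1 := hN (max N 1) (le_max_left _ _)
  rw [Real.dist_eq, sub_zero, ← htail] at h1
  push_cast at h1 ⊢
  exact (le_abs_self _).trans h1.le

end Weights

end Literature.Analysis.FluidPDE.FourierNS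

end
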